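import Mathlib
import Literature.Probability.LatticeModels.SRWKilledWalkFunctionals
import Literature.Probability.LatticeModels.GreenBoundaryFactorisation
import Literature.Probability.LatticeModels.MeshDomainJordan
import Literature.Probability.LatticeModels.DiscreteGreenKernelConvergenceJordan
import Literature.Probability.RandomPlanarGeometry.ConformalRectangle
import Literature.Probability.RandomPlanarGeometry.ConformalMapCaratheodoryProofs
import HarnessLib

/-!
# MartinRatioBoundaryLimit

Topic `Literature/Probability/LatticeModels`. Named literature fact(s) relocated by the gate from `Summits/CriticalPhenomena/SAWScalingLimit/Theorems/SAWExcursionCardyRWGreenCrossRatioLimitMartin.lean`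
(accept-time relocation of `[cite]`d propositions written inline in a Summits proposal; human ruling 2026-08-15).
Sources: KozdronLawler2005.

* `Literature.Probability.LatticeModels.KozdronLawler2005_martinRatioBoundaryLimit`

Proved here (elementary, see the last section): the fact is a corollary of the companion limit fact
`KozdronLawler2005_greenBoundaryFactorisationLimit`
(`KozdronLawler2005_martinRatioBoundaryLimit_of_greenBoundaryFactorisationLimit`); its limit constant
is the quotient of the two global factors of Kozdron–Lawler's Prop. 3.10 at the Cayley images
(`martinRatioBoundaryLimit_const_eq_chord_sq_div`, `norm_exp_mul_I_sub_exp_mul_I_sq`) and the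
boundary limit of the ratio of the two half-plane Martin kernels
(`tendsto_halfPlane_martinKernel_ratio`); and (second section) the fact follows from the two
Chelkak–Wan-type inputs for the edge-killed walk — interior convergence of the lattice Martin
kernel with a boundary-vertex pole (the analogue of Chelkak–Wan 2021, Cor. 3.6) and the uniform
discrete boundary Harnack principle at `u` (the analogue of ibid., Cor. 3.8) —
(`KozdronLawler2005_martinRatioBoundaryLimit_of_martinKernelLimit_of_boundaryHarnack`), by an
assembly that is itself proved (`tendsto_martinRatio_of_interiorLimit_of_ratioOscillation`); and
(third section) both inputs follow from interior convergence of the killed Green function (GC,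
the analogue of ibid., Cor. 3.3) together with the uniform boundary Harnack principle (UBHP) —
the two inputs isolated by crux `SAWLoopFugacityFlow.AvoidanceLimit` for the same walk —
(`KozdronLawler2005_martinRatioBoundaryLimit_of_greenConvergence_of_uniformBHP`), through the
boundary limit of half-plane Green-function ratios (`tendsto_halfPlaneGreen_ratio`).
-/

namespace Literature.Probability.LatticeModels

open _root_.Filter _root_.Topology
open scoped _root_.Topology
open _root_.Literature.Probability.LatticeModels _root_.Literature.Probability.RandomPlanarGeometry
open _root_.UpperHalfPlane (upperHalfPlaneSet)

/-- **Kozdron–Lawler 2005 — boundary factorisation of the killed Green function, Martin-kernel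
(ratio) form in the scaling limit** (named fact, not proved in the tree).
M. J. Kozdron, G. F. Lawler, *Estimates of random walk exit probabilities and application to
loop-erased random walk*, Electron. J. Probab. 10 (2005) 1442–1467 (arXiv:math/0501189), Prop. 3.10:
for `A ∈ 𝒜ⁿ` (simply connected `A ∋ 0` with inradius in `[n, 2n]`), `G_A(x,y)` the Green function of
simple random walk killed on leaving `A`, `G_A(x) = G_A(0,x)`, `f_A : Ã → 𝔻` the Riemann map of the
union-of-squares domain (`f_A(0) = 0`, `f_A'(0) > 0`), `θ_A = arg f_A`, `A^{*,n} = {g_A ≥ n^{-1/16}}`: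
uniformly over `A ∈ 𝒜ⁿ`, for `x ∈ A ∖ A^{*,n}` and `y` with `|f_A(y) − e^{iθ_A(x)}| ≥ n^{-1/16} log² n`,
"`G_A(x,y) = G_A(x) (1 − |f_A(y)|²)/|f_A(y) − e^{iθ_A(x)}|² [1 + O(n^{-1/16} log n / |f_A(y) − e^{iθ_A(x)}|)]`,
`y ∈ A^{*,n}`" and "`G_A(x,y) = (π/2) G_A(x) G_A(y) / (1 − cos(θ_A(x) − θ_A(y))) [1 + O(n^{-1/16} log n /
|θ_A(y) − θ_A(x)|)]`, `y ∈ A ∖ A^{*,n}`". DIVIDING two instances with the same `x` and two poles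
`y = q, e ∈ A ∖ A^{*,n}` (second display), resp. reading the first display with the roles of `x` and
the pole exchanged (`G_A` is symmetric), the local factor `G_A(x)` of the evaluation point CANCELS:
`[G_A(x,q)/G_A(q)] / [G_A(x,e)/G_A(e)] = (1 − cos(θ_A(x) − θ_A(e))) / (1 − cos(θ_A(x) − θ_A(q))) · [1 + O(…)]`,
whatever the conformal depth of `x` — the ratio of the two Martin kernels (Poisson kernels of `𝔻`
normalised at the base point) with poles `θ_A(q)`, `θ_A(e)`, evaluated at `x`. SCALING-LIMIT FORM
STATED HERE (the form consumed by route `SAWExcursionCardy` of `Summits/CriticalPhenomena/SAWScalingLimit`,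
cf. the companion fact `KozdronLawler2005_greenBoundaryFactorisationLimit` (`GreenBoundaryFactorisation.lean`), which keeps the
local factors and the constant `π/4`; Kozdron, ALEA 2 (2006), Thm. 4.9 and Cor. 4.13–4.15 for the passage
to the `δ`-lattice approximations of a Jordan domain, Carathéodory convergence seen from the base point,
and Pommerenke 1992, Thm. 2.6, for the boundary correspondence): `Ω` a Jordan domain (`JordanDomain`),
`Ω_δ = discreteDomainGraph Ω δ` its lattice approximation (largest component of `Ω ∩ δℤ²`, closed mesh
edges inside `Ω̄`), `G = SRW.killedGreen (discreteDomainGraph Ω δ)` (the walk run along `Ω_δ`-edges and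
killed at its first non-`Ω_δ` step), `ψ : ℍ → Ω` a `ConformalEquiv` with boundary values
`ψ(s) = u`, `ψ(t) = v`, `ψ(r) = w` at three distinct reals (`HasBoundaryValue`), `u, v, w` three
distinct points of `∂Ω`; lattice families: an evaluation family `p_δ ∈ Ω_δ` with `δ p_δ → u` (at any
rate: boundary vertices or interior vertices at vanishing macroscopic distance), two POLE families of
boundary vertices `q_δ, e_δ ∈ ∂Ω_δ` (`meshBoundary`) with `δ q_δ → v`, `δ e_δ → w`, and a base point
`o_δ ∈ Ω_δ` with `δ o_δ → ψ(i)`. Under the Cayley map `z ↦ (z − i)/(z + i)` (`i ↦ 0`),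
`1 − cos(θ(s) − θ(t)) = 2(s − t)²/((1+s²)(1+t²))`, so the limit ratio is
`(1 − cos(θ(s) − θ(r)))/(1 − cos(θ(s) − θ(t))) = (s − r)²(1 + t²)/((s − t)²(1 + r²))` — equivalently the
boundary limit at `z → s` of `[Im z (1+t²)/|z − t|²] / [Im z (1+r²)/|z − r|²]`, the ratio of the
half-plane Martin kernels with poles `t`, `r` normalised at `i`. Conclusion:
`[G(p_δ,q_δ)/G(o_δ,q_δ)] / [G(p_δ,e_δ)/G(o_δ,e_δ)] → (s − r)²(1 + t²)/((s − t)²(1 + r²))` as `δ → 0⁺`.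
What a proof needs (and no more): interior convergence of the lattice Martin kernel
`G(·,q_δ)/G(o_δ,q_δ)` with a boundary-vertex pole, and the discrete boundary Harnack principle with
ratio convergence at the lattice scale at the single point `u`; NOT the potential-kernel constant.
Caveat recorded for the prover: Kozdron–Lawler's `A` is simply connected with all `ℤ²`-edges between
its points available; for a Jordan domain whose boundary oscillates at all scales the largest mesh
component may enclose lattice "lakes" and lose mesh edges across thin exterior filaments, a regime the
printed proof does not literally cover.
TODO(general form): the finite-volume statement with the uniform error terms of Prop. 3.10 (both
displays) over `A ∈ 𝒜ⁿ`, the excursion-kernel version (Thm. 1.1) and interior poles (Cor. 3.5).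
[cite: KozdronLawler2005, Prop. 3.10] [file Probability/LatticeModels/MartinRatioBoundaryLimit] -/
def KozdronLawler2005_martinRatioBoundaryLimit : Prop :=
  ∀ (D : JordanDomain) (ψ : ConformalEquiv upperHalfPlaneSet D.carrier) (s t r : ℝ) (u v w : ℂ),
    s ≠ t → s ≠ r → t ≠ r → u ≠ v → u ≠ w → v ≠ w →
    u ∈ frontier D.carrier → v ∈ frontier D.carrier → w ∈ frontier D.carrier →
    ψ.HasBoundaryValue s u → ψ.HasBoundaryValue t v → ψ.HasBoundaryValue r w →
    ∀ (p q e o : ℝ → Site 2),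
      Tendsto (fun δ => meshPoint δ (p δ)) (𝓝[>] 0) (𝓝 u) →
      Tendsto (fun δ => meshPoint δ (q δ)) (𝓝[>] 0) (𝓝 v) →
      Tendsto (fun δ => meshPoint δ (e δ)) (𝓝[>] 0) (𝓝 w) →
      Tendsto (fun δ => meshPoint δ (o δ)) (𝓝[>] 0) (𝓝 (ψ Complex.I)) →
      (∀ᶠ δ in 𝓝[>] 0, p δ ∈ meshDomain D.carrier δ ∧ q δ ∈ meshBoundary D.carrier δ ∧
        e δ ∈ meshBoundary D.carrier δ ∧ o δ ∈ meshDomain D.carrier δ) →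
      Tendsto (fun δ =>
          SRW.killedGreen (discreteDomainGraph D.carrier δ) (p δ) (q δ) /
              SRW.killedGreen (discreteDomainGraph D.carrier δ) (o δ) (q δ) /
            (SRW.killedGreen (discreteDomainGraph D.carrier δ) (p δ) (e δ) /
              SRW.killedGreen (discreteDomainGraph D.carrier δ) (o δ) (e δ)))
        (𝓝[>] 0) (𝓝 ((s - r) ^ 2 * (1 + t ^ 2) / ((s - t) ^ 2 * (1 + r ^ 2))))

/-! ### What dividing two instances of Prop. 3.10 gives: the constant, the continuum shadow, and
### the corollary from the companion limit fact

Status of the named fact above (literature-prover audit, 2026-08-16; source read: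
`lit read doi:10.1214/ejp.v10-294`, §2.1 p. 1448 and §3.4 pp. 1462–1463, and Kozdron, ALEA 2
(2006) = arXiv:math/0506337, §4.2–4.4). What Kozdron–Lawler PROVE is the finite-volume estimate
Prop. 3.10, eqs. (40)–(41), for `A ∈ 𝒜ⁿ` — a finite subset of `ℤ²` with `A` and `ℤ² ∖ A`
nearest-neighbour connected, the walk killed on leaving the VERTEX set `A`, the angle `θ_A = arg f_A`
of the Riemann map of the union-of-squares domain of the DISCRETE set `A` — vendored as printed in
`ExcursionPoissonKernelAsymptotics.lean` (`KozdronLawler_greenFunctionBoundary`, eq. (41)). Dividing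
the two instances `(x, y) = (p, q)` and `(p, e)` of (41) (resp. of (40) when `p` lies in the bulk
`A^{*,n}`) cancels the local factor `G_A(p)` and leaves
`(1 − cos(θ_A(p) − θ_A(e)))/(1 − cos(θ_A(p) − θ_A(q))) · [1 + O(n^{-1/16} log n / Δθ)]`, which is the
content of the `δ → 0⁺` statement above up to two passages that are NOT in the cited sources:
(i) `θ_{A_δ}` at the lattice points `p_δ, q_δ, e_δ → u, v, w ∈ ∂Ω` is replaced by the continuum
boundary correspondence of `Ω` through `ψ` (Kozdron 2006, Thm. 4.9, is Carathéodory convergence of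
the union-of-squares domains on compacta, for his INNER approximation `D_N`; his Cor. 4.13–4.15 keep
the discrete angle `θ_{D_N}`; convergence of the lattice Riemann maps up to the boundary is a
Radó-type statement, cf. `RadoConvergence.lean`), and (ii) the walk runs on
`discreteDomainGraph Ω δ` (largest mesh component, closed mesh edges inside `Ω̄`: killed on EDGES,
and for a general Jordan domain not simply connected in the `ℤ²` sense), a discretisation none of
Kozdron–Lawler 2005, Kozdron 2006, Lawler–Schramm–Werner 2004, Chelkak–Smirnov 2011 or
Chelkak–Wan 2021 treats (see the module docstrings of `DiscreteGreenKernelConvergence.lean` and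
`DiscreteBoundaryHarnack.lean`). For the record (source read 2026-08-16, `lit read
arxiv:math/0112234`, §2.2 and §5.2): the classical printed form of the interior convergence of the
lattice Martin kernel with a boundary pole — hypothesis `H1` of the last section — is
Lawler–Schramm–Werner, Ann. Probab. 32 (2004), Prop. 2.2 ("Hitting probability": for every `ε > 0`
there is `r₀` such that for every simply connected GRID domain `D` with inradius `> r₀`, every
boundary vertex `u` and every vertex `w` with `|ψ_D(w)| ≤ 1 − ε`,
`|H(w,u)/H(0,u) − (1 − |ψ_D(w)|²)/|ψ_D(w) − ψ_D(u)|²| < ε`), uniform over domains but, like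
Chelkak–Wan's Cor. 3.6, for the walk stopped on hitting `∂D`, i.e. VERTEX-killed on the induced
subgraph `D ∩ ℤ²` (general domains enter through the inner grid approximation), and it has no
lattice-scale statement at a third boundary point (hypothesis `H2`). In the tree
the fact is a COROLLARY of the companion limit fact `KozdronLawler2005_greenBoundaryFactorisationLimit`
(`GreenBoundaryFactorisation.lean`; the same two passages apply to it), by the division below
(`KozdronLawler2005_martinRatioBoundaryLimit_of_greenBoundaryFactorisationLimit`, ported from
`Summits/CriticalPhenomena/SAWScalingLimit/Theorems/SAWExcursionCardyRWGreenCrossRatioLimitMartin.lean`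
so that the implication is visible inside `Literature`). The other lemmas check the elementary
pieces of the passage: the limit constant `(s − r)²(1 + t²)/((s − t)²(1 + r²))` IS the quotient of
the two global factors `(π/2)/(1 − cos Δθ)` of (41) at the Cayley images `C(s), C(t), C(r)`,
`C(z) = (z − i)/(z + i)` (`1 − cos(θ − θ') = ‖e^{iθ} − e^{iθ'}‖²/2`,
`‖C(s) − C(t)‖² = 4(s − t)²/((1 + s²)(1 + t²))`), and it IS the boundary limit at `s` of the ratio of
the two half-plane Martin kernels `Im z (1 + t²)/|z − t|²`, `Im z (1 + r²)/|z − r|²` normalised at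
`i` (the continuum boundary Harnack ratio that the lattice statement discretises).

Verdict of the provefact seat (2026-08-16, three sessions): MISSTATED relative to its cite — the
statement Kozdron–Lawler prove is `KozdronLawler_greenFunctionBoundary` (already in the tree, so no
corrected statement is proposed under a new name); the named fact above is a folklore-true but
UNPRINTED scaling-limit statement for the edge-killed discretisation, i.e. an obligation of the
consuming route rather than literature. It is closed, inside this file, from either
`KozdronLawler2005_greenBoundaryFactorisationLimit` (first section) or the two edge-killed inputs
`H1`, `H2` (last section); a restating seat should deprecate the `def` (keeping the proved
theorems) rather than re-word it, and the dependent
`Summits/CriticalPhenomena/SAWScalingLimit/Theorems/SAWExcursionCardyRWGreenCrossRatioLimitMartin.lean`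
should take `H1`, `H2` as statement items (or move to the vertex-killed inner grid approximation,
where LSW 2004 Prop. 2.2 / Chelkak–Wan Cor. 3.6 and Cor. 3.8 are citable).
-/

/-- Chord between two points of the unit circle against the cosine of the angle difference:
`‖e^{ia} − e^{ib}‖² = 2(1 − cos(a − b))` — the dictionary between the chord form `π/‖e_x − e_y‖²`
of `KozdronLawler_greenFunctionBoundary` and the printed global factor
`(π/2)/(1 − cos(θ_A(x) − θ_A(y)))` of Kozdron–Lawler 2005, Prop. 3.10. [folklore] -/
theorem norm_exp_mul_I_sub_exp_mul_I_sq (a b : ℝ) :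
    ‖Complex.exp (a * Complex.I) - Complex.exp (b * Complex.I)‖ ^ 2 =
      2 * (1 - Real.cos (a - b)) := by
  rw [Complex.sq_norm, Complex.normSq_apply]
  simp only [Complex.sub_re, Complex.sub_im, Complex.exp_ofReal_mul_I_re,
    Complex.exp_ofReal_mul_I_im]
  rw [Real.cos_sub]
  nlinarith [Real.sin_sq_add_cos_sq a, Real.sin_sq_add_cos_sq b]

/-- **The limit constant of `KozdronLawler2005_martinRatioBoundaryLimit` is the quotient of the two
global factors of Kozdron–Lawler's Prop. 3.10 at the Cayley images of `s, t, r`:**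
`(s − r)²(1 + t²)/((s − t)²(1 + r²)) = ‖C(s) − C(r)‖² / ‖C(s) − C(t)‖²`
(`= (1 − cos(θ(s) − θ(r)))/(1 − cos(θ(s) − θ(t)))` for `e^{iθ(·)} = C(·)`, by
`norm_exp_mul_I_sub_exp_mul_I_sq`), `C(z) = (z − i)/(z + i)` the disc uniformizer sending the base
point `i` to `0`. This is the division of the two instances `(p,q)`, `(p,e)` of eq. (41) with the local
factors cancelled; elementary (Cayley algebra, `norm_cayley_sub_cayley_sq`). The analytic passage to
the lattice statement is NOT proved here (see the section docstring).
[cite: KozdronLawler2005, Prop. 3.10] -/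
theorem martinRatioBoundaryLimit_const_eq_chord_sq_div (s t r : ℝ) (hst : s ≠ t) :
    (s - r) ^ 2 * (1 + t ^ 2) / ((s - t) ^ 2 * (1 + r ^ 2)) =
      ‖((s : ℂ) - Complex.I) / ((s : ℂ) + Complex.I) -
          ((r : ℂ) - Complex.I) / ((r : ℂ) + Complex.I)‖ ^ 2 /
        ‖((s : ℂ) - Complex.I) / ((s : ℂ) + Complex.I) -
          ((t : ℂ) - Complex.I) / ((t : ℂ) + Complex.I)‖ ^ 2 := by
  rw [norm_cayley_sub_cayley_sq, norm_cayley_sub_cayley_sq]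
  have e1 : (s - t) ^ 2 ≠ 0 := pow_ne_zero 2 (sub_ne_zero.2 hst)
  have p0 : (1 + s ^ 2) ≠ 0 := by positivity
  have p1 : (1 + t ^ 2) ≠ 0 := by positivity
  have p2 : (1 + r ^ 2) ≠ 0 := by positivity
  field_simp

/-- **Continuum shadow of the fact: the boundary limit of the ratio of two half-plane Martin
kernels.** For real `s ≠ t` and real `r`, as `z → s` inside the upper half-plane,
`[Im z (1 + t²)/|z − t|²] / [Im z (1 + r²)/|z − r|²] → (s − r)²(1 + t²)/((s − t)²(1 + r²))`:
the two Martin kernels of `ℍ` with poles `t`, `r`, normalised at the base point `i`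
(`Im i/|i − t|² = 1/(1 + t²)`), have a ratio that extends continuously to the boundary point `s`
(the boundary Harnack principle in `ℍ`, here explicit), and its value there is the limit constant of
`KozdronLawler2005_martinRatioBoundaryLimit`. Elementary: `Im z > 0` cancels on `ℍ`.
[cite: KozdronLawler2005, Prop. 3.10] -/
theorem tendsto_halfPlane_martinKernel_ratio (s t r : ℝ) (hst : s ≠ t) :
    Tendsto (fun z : ℂ => z.im * (1 + t ^ 2) / ‖z - t‖ ^ 2 / (z.im * (1 + r ^ 2) / ‖z - r‖ ^ 2))
      (𝓝[upperHalfPlaneSet] (s : ℂ))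
      (𝓝 ((s - r) ^ 2 * (1 + t ^ 2) / ((s - t) ^ 2 * (1 + r ^ 2)))) := by
  set g : ℂ → ℝ := fun z => (1 + t ^ 2) * ‖z - r‖ ^ 2 / ((1 + r ^ 2) * ‖z - t‖ ^ 2) with hg
  have hgs : g s = (s - r) ^ 2 * (1 + t ^ 2) / ((s - t) ^ 2 * (1 + r ^ 2)) := by
    simp only [hg, ← Complex.ofReal_sub, Complex.norm_real, Real.norm_eq_abs, sq_abs]
    ring
  have hcont : ContinuousAt g s := by
    have h1 : ((1 + r ^ 2) * ‖(s : ℂ) - t‖ ^ 2) ≠ 0 := by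
      have : ‖(s : ℂ) - t‖ ≠ 0 := by
        rw [← Complex.ofReal_sub, Complex.norm_real, Real.norm_eq_abs]
        exact abs_ne_zero.2 (sub_ne_zero.2 hst)
      positivity
    have hf : ContinuousAt (fun z : ℂ => (1 + t ^ 2) * ‖z - r‖ ^ 2) s := by fun_prop
    have hd : ContinuousAt (fun z : ℂ => (1 + r ^ 2) * ‖z - t‖ ^ 2) s := by fun_prop
    exact hf.div hd h1
  rw [← hgs]
  refine ((hcont.tendsto).mono_left nhdsWithin_le_nhds).congr' ?_
  filter_upwards [self_mem_nhdsWithin] with z hz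
  have hz' : 0 < z.im := hz
  have him : z.im ≠ 0 := hz'.ne'
  simp only [hg]
  rw [div_div_div_comm]
  by_cases ht : ‖z - t‖ = 0
  · simp [ht]
  by_cases hr : ‖z - r‖ = 0
  · simp [hr]
  field_simp

/-- **The ratio form follows from the full factorisation**
(`KozdronLawler2005_greenBoundaryFactorisationLimit → KozdronLawler2005_martinRatioBoundaryLimit`):
dividing the two instances `G(p,q)/(G(o,p) G(o,q)) → (π/4)(1+s²)(1+t²)/(s−t)²` (pole `q → v`) and
`G(p,e)/(G(o,p) G(o,e)) → (π/4)(1+s²)(1+r²)/(s−r)²` (pole `e → w`) of the companion limit fact, the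
local factor `G(o,p)` of the evaluation point and the constant `π/4 · (1+s²)` cancel (the second
limit is nonzero, so `G(o,p) ≠ 0` eventually). This is the division of the two displays of
Kozdron–Lawler 2005, Prop. 3.10, performed on the limit statements; ported verbatim from
`Summit.CriticalPhenomena.SAWScalingLimit.Theorems.martinRatioBoundaryLimit_of_greenBoundaryFactorisation`
so that the implication between the two named facts is recorded inside `Literature` (once
`KozdronLawler2005_greenBoundaryFactorisationLimit` is discharged, the fact above is discharged by this
theorem). [cite: KozdronLawler2005, Prop. 3.10] -/
theorem KozdronLawler2005_martinRatioBoundaryLimit_of_greenBoundaryFactorisationLimit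
    (hKL : KozdronLawler2005_greenBoundaryFactorisationLimit) :
    KozdronLawler2005_martinRatioBoundaryLimit := by
  intro D ψ s t r u v w hst hsr _htr _huv _huw _hvw _hu _hv _hw hs ht hr p q e o hp hq he ho hmem
  have hmem_pq : ∀ᶠ δ in 𝓝[>] 0, p δ ∈ meshDomain D.carrier δ ∧ q δ ∈ meshDomain D.carrier δ := by
    filter_upwards [hmem] with δ h
    exact ⟨h.1, meshBoundary_subset_meshDomain _ _ h.2.1⟩
  have hmem_pe : ∀ᶠ δ in 𝓝[>] 0, p δ ∈ meshDomain D.carrier δ ∧ e δ ∈ meshDomain D.carrier δ := by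
    filter_upwards [hmem] with δ h
    exact ⟨h.1, meshBoundary_subset_meshDomain _ _ h.2.2.1⟩
  have T1 := hKL D ψ s t u v hst hs ht p q o hp hq ho hmem_pq
  have T2 := hKL D ψ s r u w hsr hs hr p e o hp he ho hmem_pe
  have hL1 : Real.pi / 4 * ((1 + s ^ 2) * (1 + t ^ 2)) / (s - t) ^ 2 ≠ 0 := by
    have : (s - t) ^ 2 ≠ 0 := pow_ne_zero 2 (sub_ne_zero.2 hst)
    positivity
  have hL2 : Real.pi / 4 * ((1 + s ^ 2) * (1 + r ^ 2)) / (s - r) ^ 2 ≠ 0 := by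
    have : (s - r) ^ 2 ≠ 0 := pow_ne_zero 2 (sub_ne_zero.2 hsr)
    positivity
  have hlim : Real.pi / 4 * ((1 + s ^ 2) * (1 + t ^ 2)) / (s - t) ^ 2 /
        (Real.pi / 4 * ((1 + s ^ 2) * (1 + r ^ 2)) / (s - r) ^ 2) =
      (s - r) ^ 2 * (1 + t ^ 2) / ((s - t) ^ 2 * (1 + r ^ 2)) := by
    have e1 : (s - t) ^ 2 ≠ 0 := pow_ne_zero 2 (sub_ne_zero.2 hst)
    have e2 : (s - r) ^ 2 ≠ 0 := pow_ne_zero 2 (sub_ne_zero.2 hsr)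
    have p0 : (1 + s ^ 2) ≠ 0 := by positivity
    have p2 : (1 + r ^ 2) ≠ 0 := by positivity
    have hpi : Real.pi ≠ 0 := Real.pi_ne_zero
    field_simp
  have hmain := T1.div T2 hL2
  rw [hlim] at hmain
  refine hmain.congr' ?_
  filter_upwards [T1.eventually_ne hL1, T2.eventually_ne hL2] with δ h1 h2
  obtain ⟨_, hoq⟩ := div_ne_zero_iff.1 h1
  obtain ⟨_, hoq⟩ := mul_ne_zero_iff.1 hoq
  obtain ⟨_, hoe⟩ := div_ne_zero_iff.1 h2
  obtain ⟨hop, hoe⟩ := mul_ne_zero_iff.1 hoe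
  simp only [Pi.div_apply]
  field_simp


/-! ### The fact from the two Chelkak–Wan-type inputs for the edge-killed walk

What remains between print and the named fact, made precise (literature-prover, 2026-08-16;
sources re-read: Kozdron–Lawler 2005, Prop. 3.10, journal p. 1462; Chelkak–Wan 2021 =
arXiv:1903.08045, §2.1 and §3.1–3.2). Chelkak–Wan prove, for SIMPLY CONNECTED INDUCED subgraphs
`Ω^δ ⊂ δℤ²` approximating `(Ω; a)` in the Carathéodory sense (walk killed on vertices),
**Cor. 3.6**: `Z_{Ω^δ}(a^δ, u^δ)/Z_{Ω^δ}(a^δ, v^δ) → P_Ω(a, u)/P_Ω(a, v)` for a boundary point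
`a^δ → a` (prime end) and inner points `u, v` — convergence of the lattice Martin kernel with a
boundary pole, at interior points —, and **Cor. 3.8**: for positive discrete harmonic `H₁, H₂`
with Dirichlet conditions on the boundary near `b`,
`max_{u,v near b} (H₁(u)/H₂(u))/(H₁(v)/H₂(v)) ≤ (1 + k^q)/(1 − k^q)` on the piece of `Ω^δ` cut off
by `B(b, 2^{-q} r)`, `k < 1` universal — the uniform boundary Harnack principle (vertex form in
the tree: `ChelkakWan_uniformBoundaryHarnack`, `DiscreteBoundaryHarnack.lean`). The theorems of
this section PROVE that the named fact follows from the analogues of these two statements for the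
tree's discretisation (`discreteDomainGraph Ω δ`: largest mesh component, closed mesh edges in
`Ω̄`, walk killed on EDGES), stated as explicit hypotheses `H1`, `H2` (they are NOT vendored as
named facts: no source proves them for this discretisation; Chelkak 2016, §2.2 only remarks that
the induced-subgraph assumption "can be easily removed"):

* `tendsto_martinRatio_of_interiorLimit_of_ratioOscillation` — the assembly, for ANY family of
  vertex sets `V δ` eventually covering the compacts of `Ω` and ANY two lattice functions
  `M^q_δ, M^e_δ`: if `M^q_δ → Im z (1+t²)/|z−t|²` and `M^e_δ → Im z (1+r²)/|z−r|²` (`z = ψ⁻¹ x`)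
  along lattice approximants of every interior point `x` (H1), and the ratio `M^q_δ/M^e_δ`
  oscillates by at most `ε` on `V δ ∩ B(u, ρ(ε))` for all small `δ` (H2), then
  `M^q_δ(p_δ)/M^e_δ(p_δ) → (s − r)²(1 + t²)/((s − t)²(1 + r²))` for every `p_δ → u` in `V δ`.
  Proof: Carathéodory (`ψ⁻¹ x → s` as `x → u` inside `Ω`, from the tree's
  `JordanDomain.exists_continuousOn_extension_holds` and `JordanDomain.tendsto_symm_nhds`) and
  `tendsto_halfPlane_martinKernel_ratio` give an interior `x` near `u` where the continuum ratio
  is within `ε` of the limit; H1 transfers this to the lattice at `x`, H2 from `x` to `p_δ`.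
* `tendsto_killedGreen_martinRatio_of_interiorLimit_of_ratioOscillation` — the same for
  `G = SRW.killedGreen (discreteDomainGraph Ω δ)`, `V δ = meshDomain Ω δ`
  (`JordanDomain.eventually_forall_mem_meshDomain'`), `M^q_δ = G(·, q_δ)/G(o_δ, q_δ)`, with H2
  in the base-point-free form on `G(·, q_δ)/G(·, e_δ)` (the shape of Cor. 3.8).
* `KozdronLawler2005_martinRatioBoundaryLimit_of_martinKernelLimit_of_boundaryHarnack` — the
  named fact from the universally quantified H1 (Cor. 3.6 analogue: boundary-vertex pole
  `q_δ → v`, base point `o_δ → ψ(i)`, interior evaluation) and H2 (Cor. 3.8 analogue at `u`).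
-/

section ChelkakWanInputs

open _root_.Metric _root_.Set

/-- **Inverse boundary correspondence at a real point** (Carathéodory's theorem for the Jordan
domain `D`, half-plane form): if `ψ : ℍ → D` has boundary value `u` at the real point `s`, then
`ψ⁻¹ x → s` within `ℍ` as `x → u` within `D`. From the tree's disc form
`JordanDomain.exists_continuousOn_extension_holds` through `JordanDomain.tendsto_symm_nhds`.
[cite: PommerenkeBBCM1992, Thm. 2.6] -/
theorem conformalEquiv_symm_tendsto_nhdsWithin_of_hasBoundaryValue (D : JordanDomain)
    (ψ : ConformalEquiv upperHalfPlaneSet D.carrier) {s : ℝ} {u : ℂ}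
    (hs : ψ.HasBoundaryValue s u) :
    Tendsto ψ.symm (𝓝[D.carrier] u) (𝓝[upperHalfPlaneSet] (s : ℂ)) := by
  obtain ⟨Ψ, hΨc, hΨeq, hbij, -⟩ :=
    JordanDomain.exists_continuousOn_extension_holds D (cayley.symm.trans ψ)
  have h := JordanDomain.tendsto_symm_nhds ψ hΨc hΨeq hbij.injOn hs
  refine tendsto_nhdsWithin_iff.2 ⟨h, ?_⟩
  filter_upwards [self_mem_nhdsWithin] with x hx
  exact ψ.symm_mapsTo hx

/-- The half-plane Martin kernel with pole `t ∈ ℝ` normalised at `i`, `Im z (1 + t²)/|z − t|²`,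
is positive on `ℍ`. [folklore] -/
theorem halfPlane_martinKernel_pos (t : ℝ) {z : ℂ} (hz : z ∈ upperHalfPlaneSet) :
    0 < z.im * (1 + t ^ 2) / ‖z - t‖ ^ 2 := by
  have hz' : 0 < z.im := hz
  have hne : z - (t : ℂ) ≠ 0 := by
    intro h
    have := congrArg Complex.im h
    simp only [Complex.sub_im, Complex.ofReal_im, sub_zero, Complex.zero_im] at this
    exact hz'.ne' this
  have : 0 < ‖z - (t : ℂ)‖ := norm_pos_iff.2 hne
  positivity

/-- Passing between the two normalisations of the boundary Harnack ratio: with nonzero base-point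
values `b = G(o,q)`, `d = G(o,e)`, `[(a/b)/(c/d)] / [(a'/b)/(c'/d)] = (a/c)/(a'/c')`. [folklore] -/
private theorem div_div_div_div_normalisation {a b c d a' c' : ℝ} (hb : b ≠ 0) (hd : d ≠ 0) :
    a / b / (c / d) / (a' / b / (c' / d)) = a / c / (a' / c') := by
  rw [div_div_div_comm a b c d, div_div_div_comm a' b c' d,
    div_div_div_cancel_right₀ (div_ne_zero hb hd)]

/-- **Assembly: interior Martin-kernel limits + ratio oscillation at `u` ⟹ the boundary limit of
the Martin ratio.** `D` a Jordan domain, `ψ : ℍ → D` conformal with boundary value `u ∈ ∂D` at the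
real point `s`, `t ≠ s` and `r` real; `V δ ⊆ ℤ²` vertex sets eventually containing the lattice
points of every compact `K ⊆ D`; `M^q_δ, M^e_δ : ℤ² → ℝ` two families of lattice functions
(the lattice Martin kernels with poles near `ψ(t)`, `ψ(r)`). Hypotheses: (H1) along every lattice
family `x_δ ∈ V δ` with `δ x_δ → x ∈ D`, `M^q_δ(x_δ) → Im z (1+t²)/|z−t|²` and
`M^e_δ(x_δ) → Im z (1+r²)/|z−r|²`, `z = ψ⁻¹(x)` (interior convergence to the half-plane Martin
kernels normalised at `i`; the shape of Chelkak–Wan 2021, Cor. 3.6); (H2) for every `ε > 0` there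
is `ρ > 0` such that for all small `δ` the ratio `M^q_δ/M^e_δ` satisfies
`|R(x)/R(x') − 1| ≤ ε` for `x, x' ∈ V δ` with mesh points in `B(u, ρ)` (uniform boundary Harnack
principle at `u`; the shape of ibid., Cor. 3.8). Conclusion: for every lattice family `p_δ ∈ V δ`
with `δ p_δ → u` (at any rate), `M^q_δ(p_δ)/M^e_δ(p_δ) → (s − r)²(1 + t²)/((s − t)²(1 + r²))`.
Proof: by Carathéodory (`conformalEquiv_symm_tendsto_nhdsWithin_of_hasBoundaryValue`) and
`tendsto_halfPlane_martinKernel_ratio` the continuum ratio tends to the limit `L` at `u` inside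
`D`, so some interior `x ∈ B(u, ρ/2)` has ratio within `ε` of `L`; by H1 at the approximants
`x_δ = nearestSite δ x` the lattice ratio there is within `ε` of it for small `δ`, and by H2
`R(p_δ) = (R(p_δ)/R(x_δ)) R(x_δ)` with `|R(p_δ)/R(x_δ) − 1| ≤ ε`; hence
`|R(p_δ) − L| ≤ (|L| + 4) ε` eventually. [cite: ChelkakWan2021, Cor. 3.6 and Cor. 3.8] -/
theorem tendsto_martinRatio_of_interiorLimit_of_ratioOscillation
    (D : JordanDomain) (ψ : ConformalEquiv upperHalfPlaneSet D.carrier) {s t r : ℝ} {u : ℂ}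
    (hst : s ≠ t) (hu : u ∈ frontier D.carrier) (hs : ψ.HasBoundaryValue s u)
    (V : ℝ → Set (Site 2))
    (hV : ∀ K : Set ℂ, IsCompact K → K ⊆ D.carrier →
      ∀ᶠ δ in 𝓝[>] 0, ∀ x : Site 2, meshPoint δ x ∈ K → x ∈ V δ)
    (Mq Me : ℝ → Site 2 → ℝ)
    (H1q : ∀ x ∈ D.carrier, ∀ xs : ℝ → Site 2,
      Tendsto (fun δ => meshPoint δ (xs δ)) (𝓝[>] 0) (𝓝 x) → (∀ᶠ δ in 𝓝[>] 0, xs δ ∈ V δ) →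
      Tendsto (fun δ => Mq δ (xs δ)) (𝓝[>] 0)
        (𝓝 ((ψ.symm x).im * (1 + t ^ 2) / ‖ψ.symm x - t‖ ^ 2)))
    (H1e : ∀ x ∈ D.carrier, ∀ xs : ℝ → Site 2,
      Tendsto (fun δ => meshPoint δ (xs δ)) (𝓝[>] 0) (𝓝 x) → (∀ᶠ δ in 𝓝[>] 0, xs δ ∈ V δ) →
      Tendsto (fun δ => Me δ (xs δ)) (𝓝[>] 0)
        (𝓝 ((ψ.symm x).im * (1 + r ^ 2) / ‖ψ.symm x - r‖ ^ 2)))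
    (H2 : ∀ ε > 0, ∃ ρ > 0, ∀ᶠ δ in 𝓝[>] 0, ∀ x x' : Site 2, x ∈ V δ → x' ∈ V δ →
      dist (meshPoint δ x) u < ρ → dist (meshPoint δ x') u < ρ →
      |Mq δ x / Me δ x / (Mq δ x' / Me δ x') - 1| ≤ ε)
    (p : ℝ → Site 2) (hp : Tendsto (fun δ => meshPoint δ (p δ)) (𝓝[>] 0) (𝓝 u))
    (hpV : ∀ᶠ δ in 𝓝[>] 0, p δ ∈ V δ) :
    Tendsto (fun δ => Mq δ (p δ) / Me δ (p δ)) (𝓝[>] 0)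
      (𝓝 ((s - r) ^ 2 * (1 + t ^ 2) / ((s - t) ^ 2 * (1 + r ^ 2)))) := by
  set L : ℝ := (s - r) ^ 2 * (1 + t ^ 2) / ((s - t) ^ 2 * (1 + r ^ 2)) with hL
  -- the continuum ratio `Φ` and its boundary limit at `u`
  set Φ : ℂ → ℝ := fun x => (ψ.symm x).im * (1 + t ^ 2) / ‖ψ.symm x - t‖ ^ 2 /
    ((ψ.symm x).im * (1 + r ^ 2) / ‖ψ.symm x - r‖ ^ 2) with hΦ
  have hΦlim : Tendsto Φ (𝓝[D.carrier] u) (𝓝 L) :=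
    (tendsto_halfPlane_martinKernel_ratio s t r hst).comp
      (conformalEquiv_symm_tendsto_nhdsWithin_of_hasBoundaryValue D ψ hs)
  haveI hne : (𝓝[D.carrier] u).NeBot :=
    mem_closure_iff_nhdsWithin_neBot.1 (frontier_subset_closure hu)
  -- the key estimate: for `0 < ε ≤ 1`, eventually `|R(p_δ) - L| ≤ (|L| + 4) ε`
  have key : ∀ ε : ℝ, 0 < ε → ε ≤ 1 →
      ∀ᶠ δ in 𝓝[>] 0, |Mq δ (p δ) / Me δ (p δ) - L| ≤ (|L| + 4) * ε := by
    intro ε hε hε1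
    obtain ⟨ρ, hρ, hosc⟩ := H2 ε hε
    -- an interior point `x` near `u` where the continuum ratio is within `ε` of `L`
    have hev : ∀ᶠ x in 𝓝[D.carrier] u, dist (Φ x) L < ε ∧ (dist x u < ρ / 2 ∧ x ∈ D.carrier) := by
      refine (Metric.tendsto_nhds.1 hΦlim ε hε).and ?_
      refine Filter.inter_mem ?_ self_mem_nhdsWithin
      exact mem_nhdsWithin_of_mem_nhds (Metric.ball_mem_nhds u (half_pos hρ))
    obtain ⟨x, hΦx, hxu, hxD⟩ := hev.exists
    -- its lattice approximants
    set xs : ℝ → Site 2 := fun δ => nearestSite δ x with hxs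
    obtain ⟨η, hη, hηD⟩ := Metric.isOpen_iff.1 D.isOpen x hxD
    have hK : IsCompact (closedBall x (η / 2)) := isCompact_closedBall x (η / 2)
    have hKD : closedBall x (η / 2) ⊆ D.carrier :=
      (closedBall_subset_ball (half_lt_self hη)).trans hηD
    have hδpos : ∀ᶠ δ in 𝓝[>] (0 : ℝ), 0 < δ := self_mem_nhdsWithin
    have hδlt : ∀ c : ℝ, 0 < c → ∀ᶠ δ in 𝓝[>] (0 : ℝ), δ < c := fun c hc =>
      mem_of_superset (Ioo_mem_nhdsGT hc) fun δ hδ => hδ.2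
    have hxs_dist : ∀ᶠ δ in 𝓝[>] (0 : ℝ), dist (meshPoint δ (xs δ)) x ≤ δ := by
      filter_upwards [hδpos] with δ hδ
      exact dist_meshPoint_nearestSite_le hδ x
    have hxs_tend : Tendsto (fun δ => meshPoint δ (xs δ)) (𝓝[>] 0) (𝓝 x) := by
      rw [tendsto_iff_dist_tendsto_zero]
      have h0 : Tendsto (fun δ : ℝ => δ) (𝓝[>] (0 : ℝ)) (𝓝 0) :=
        tendsto_nhdsWithin_of_tendsto_nhds tendsto_id
      refine squeeze_zero' (Eventually.of_forall fun δ => dist_nonneg) hxs_dist h0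
    have hxs_mem : ∀ᶠ δ in 𝓝[>] (0 : ℝ), xs δ ∈ V δ := by
      filter_upwards [hV _ hK hKD, hxs_dist, hδlt _ (half_pos hη)] with δ hVδ hd hδη
      exact hVδ _ (mem_closedBall.2 (hd.trans hδη.le))
    -- the interior limit at `x`
    have hzH : ψ.symm x ∈ upperHalfPlaneSet := ψ.symm_mapsTo hxD
    have hMr : 0 < (ψ.symm x).im * (1 + r ^ 2) / ‖ψ.symm x - r‖ ^ 2 :=
      halfPlane_martinKernel_pos r hzH
    have hRx : Tendsto (fun δ => Mq δ (xs δ) / Me δ (xs δ)) (𝓝[>] 0) (𝓝 (Φ x)) :=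
      (H1q x hxD xs hxs_tend hxs_mem).div (H1e x hxD xs hxs_tend hxs_mem) hMr.ne'
    have hΦx_pos : 0 < Φ x := div_pos (halfPlane_martinKernel_pos t hzH) hMr
    have hRx_ne : ∀ᶠ δ in 𝓝[>] (0 : ℝ), Mq δ (xs δ) / Me δ (xs δ) ≠ 0 :=
      hRx.eventually_ne hΦx_pos.ne'
    have hRx_close : ∀ᶠ δ in 𝓝[>] (0 : ℝ), dist (Mq δ (xs δ) / Me δ (xs δ)) (Φ x) < ε :=
      Metric.tendsto_nhds.1 hRx ε hε
    have hp_close : ∀ᶠ δ in 𝓝[>] (0 : ℝ), dist (meshPoint δ (p δ)) u < ρ :=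
      Metric.tendsto_nhds.1 hp ρ hρ
    filter_upwards [hosc, hpV, hxs_mem, hp_close, hxs_dist, hδlt _ (half_pos hρ), hRx_ne,
      hRx_close] with δ hoscδ hpVδ hxsVδ hpρ hxsd hδρ hRne hRclose
    have hxs_close : dist (meshPoint δ (xs δ)) u < ρ :=
      calc dist (meshPoint δ (xs δ)) u ≤ dist (meshPoint δ (xs δ)) x + dist x u :=
            dist_triangle _ _ _
        _ < ρ / 2 + ρ / 2 := add_lt_add (hxsd.trans_lt hδρ) hxu
        _ = ρ := by ring
    have h1 := hoscδ (p δ) (xs δ) hpVδ hxsVδ hpρ hxs_close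
    set Rp := Mq δ (p δ) / Me δ (p δ) with hRp
    set Rx := Mq δ (xs δ) / Me δ (xs δ) with hRxd
    rw [Real.dist_eq] at hRclose hΦx
    have hRx_bd : |Rx| ≤ |L| + 2 := by
      have h3 : |Rx| ≤ |Rx - Φ x| + |Φ x - L| + |L| := by
        calc |Rx| = |(Rx - Φ x) + (Φ x - L) + L| := by ring_nf
          _ ≤ |(Rx - Φ x) + (Φ x - L)| + |L| := abs_add_le _ _
          _ ≤ |Rx - Φ x| + |Φ x - L| + |L| := by
              have := abs_add_le (Rx - Φ x) (Φ x - L); linarith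
      linarith
    have hid : Rp - L = (Rp / Rx - 1) * Rx + (Rx - Φ x) + (Φ x - L) := by
      rw [sub_mul, div_mul_cancel₀ _ hRne]; ring
    have hprod : |(Rp / Rx - 1) * Rx| ≤ ε * (|L| + 2) := by
      rw [abs_mul]
      exact mul_le_mul h1 hRx_bd (abs_nonneg _) hε.le
    calc |Rp - L| = |(Rp / Rx - 1) * Rx + (Rx - Φ x) + (Φ x - L)| := by rw [hid]
      _ ≤ |(Rp / Rx - 1) * Rx + (Rx - Φ x)| + |Φ x - L| := abs_add_le _ _
      _ ≤ |(Rp / Rx - 1) * Rx| + |Rx - Φ x| + |Φ x - L| := by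
          have := abs_add_le ((Rp / Rx - 1) * Rx) (Rx - Φ x); linarith
      _ ≤ ε * (|L| + 2) + ε + ε := by linarith
      _ = (|L| + 4) * ε := by ring
  -- conclusion
  rw [Metric.tendsto_nhds]
  intro ε₀ hε₀
  have hC : 0 < |L| + 4 := by positivity
  set ε : ℝ := min 1 (ε₀ / (2 * (|L| + 4))) with hεdef
  have hε : 0 < ε := lt_min one_pos (by positivity)
  have hε1 : ε ≤ 1 := min_le_left _ _
  have hε2 : ε ≤ ε₀ / (2 * (|L| + 4)) := min_le_right _ _
  filter_upwards [key ε hε hε1] with δ hδ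
  rw [Real.dist_eq]
  calc |Mq δ (p δ) / Me δ (p δ) - L| ≤ (|L| + 4) * ε := hδ
    _ ≤ (|L| + 4) * (ε₀ / (2 * (|L| + 4))) := by gcongr
    _ = ε₀ / 2 := by field_simp
    _ < ε₀ := half_lt_self hε₀


/-- **The same for the edge-killed walk on `Ω_δ = discreteDomainGraph Ω δ`.** With
`G = SRW.killedGreen (discreteDomainGraph D.carrier δ)`, lattice Martin kernels
`M^q_δ = G(·, q_δ)/G(o_δ, q_δ)`, `M^e_δ = G(·, e_δ)/G(o_δ, e_δ)` and `V δ = meshDomain D.carrier δ`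
(which eventually contains the lattice points of every compact of `D`,
`JordanDomain.eventually_forall_mem_meshDomain'`): if (H1) each of the two lattice Martin kernels
converges at interior points to the half-plane Martin kernel normalised at `i` (the analogue, for
the edge-killed walk, of Chelkak–Wan 2021, Cor. 3.6), and (H2) the base-point-free ratio
`G(·, q_δ)/G(·, e_δ)` oscillates by at most `ε` over the vertices of `Ω_δ` with mesh point in
`B(u, ρ(ε))`, for all small `δ` (the analogue of ibid., Cor. 3.8: `G(·, q_δ)`, `G(·, e_δ)` are
positive, harmonic for the killed walk off their poles, which stay away from `u`, and vanish where
the walk is killed), then `[G(p_δ,q_δ)/G(o_δ,q_δ)] / [G(p_δ,e_δ)/G(o_δ,e_δ)] → (s − r)²(1 + t²)/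
((s − t)²(1 + r²))` for every `p_δ ∈ Ω_δ` with `δ p_δ → u`. (The normalisations `G(o_δ, q_δ)`,
`G(o_δ, e_δ)` are eventually nonzero by H1 at one interior point, so the two forms of H2 agree.)
[cite: ChelkakWan2021, Cor. 3.6 and Cor. 3.8] -/
theorem tendsto_killedGreen_martinRatio_of_interiorLimit_of_ratioOscillation
    (D : JordanDomain) (ψ : ConformalEquiv upperHalfPlaneSet D.carrier) {s t r : ℝ} {u : ℂ}
    (hst : s ≠ t) (hu : u ∈ frontier D.carrier) (hs : ψ.HasBoundaryValue s u)
    (p q e o : ℝ → Site 2)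
    (hp : Tendsto (fun δ => meshPoint δ (p δ)) (𝓝[>] 0) (𝓝 u))
    (hpmem : ∀ᶠ δ in 𝓝[>] 0, p δ ∈ meshDomain D.carrier δ)
    (H1q : ∀ x ∈ D.carrier, ∀ xs : ℝ → Site 2,
      Tendsto (fun δ => meshPoint δ (xs δ)) (𝓝[>] 0) (𝓝 x) →
      (∀ᶠ δ in 𝓝[>] 0, xs δ ∈ meshDomain D.carrier δ) →
      Tendsto (fun δ => SRW.killedGreen (discreteDomainGraph D.carrier δ) (xs δ) (q δ) /
          SRW.killedGreen (discreteDomainGraph D.carrier δ) (o δ) (q δ)) (𝓝[>] 0)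
        (𝓝 ((ψ.symm x).im * (1 + t ^ 2) / ‖ψ.symm x - t‖ ^ 2)))
    (H1e : ∀ x ∈ D.carrier, ∀ xs : ℝ → Site 2,
      Tendsto (fun δ => meshPoint δ (xs δ)) (𝓝[>] 0) (𝓝 x) →
      (∀ᶠ δ in 𝓝[>] 0, xs δ ∈ meshDomain D.carrier δ) →
      Tendsto (fun δ => SRW.killedGreen (discreteDomainGraph D.carrier δ) (xs δ) (e δ) /
          SRW.killedGreen (discreteDomainGraph D.carrier δ) (o δ) (e δ)) (𝓝[>] 0)
        (𝓝 ((ψ.symm x).im * (1 + r ^ 2) / ‖ψ.symm x - r‖ ^ 2)))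
    (H2 : ∀ ε > 0, ∃ ρ > 0, ∀ᶠ δ in 𝓝[>] 0, ∀ x x' : Site 2,
      x ∈ meshDomain D.carrier δ → x' ∈ meshDomain D.carrier δ →
      dist (meshPoint δ x) u < ρ → dist (meshPoint δ x') u < ρ →
      |SRW.killedGreen (discreteDomainGraph D.carrier δ) x (q δ) /
            SRW.killedGreen (discreteDomainGraph D.carrier δ) x (e δ) /
          (SRW.killedGreen (discreteDomainGraph D.carrier δ) x' (q δ) /
            SRW.killedGreen (discreteDomainGraph D.carrier δ) x' (e δ)) - 1| ≤ ε) :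
    Tendsto (fun δ =>
        SRW.killedGreen (discreteDomainGraph D.carrier δ) (p δ) (q δ) /
            SRW.killedGreen (discreteDomainGraph D.carrier δ) (o δ) (q δ) /
          (SRW.killedGreen (discreteDomainGraph D.carrier δ) (p δ) (e δ) /
            SRW.killedGreen (discreteDomainGraph D.carrier δ) (o δ) (e δ)))
      (𝓝[>] 0) (𝓝 ((s - r) ^ 2 * (1 + t ^ 2) / ((s - t) ^ 2 * (1 + r ^ 2)))) := by
  -- abbreviations
  set G : ℝ → Site 2 → Site 2 → ℝ := fun δ => SRW.killedGreen (discreteDomainGraph D.carrier δ)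
    with hG
  have hV : ∀ K : Set ℂ, IsCompact K → K ⊆ D.carrier →
      ∀ᶠ δ in 𝓝[>] 0, ∀ x : Site 2, meshPoint δ x ∈ K → x ∈ meshDomain D.carrier δ :=
    fun K hK hKD => (D.eventually_forall_mem_meshDomain' hK hKD).mono fun δ h => h.1
  -- the two normalisations `G(o,q)`, `G(o,e)` are eventually nonzero (from `H1` at one point)
  have hnz : ∀ᶠ δ in 𝓝[>] (0 : ℝ), G δ (o δ) (q δ) ≠ 0 ∧ G δ (o δ) (e δ) ≠ 0 := by
    obtain ⟨x₀, hx₀⟩ := D.isConnected.nonempty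
    obtain ⟨η, hη, hηD⟩ := Metric.isOpen_iff.1 D.isOpen x₀ hx₀
    have hKD : closedBall x₀ (η / 2) ⊆ D.carrier :=
      (closedBall_subset_ball (half_lt_self hη)).trans hηD
    have hδpos : ∀ᶠ δ in 𝓝[>] (0 : ℝ), 0 < δ := self_mem_nhdsWithin
    have hδlt : ∀ᶠ δ in 𝓝[>] (0 : ℝ), δ < η / 2 :=
      mem_of_superset (Ioo_mem_nhdsGT (half_pos hη)) fun δ hδ => hδ.2
    have hdist : ∀ᶠ δ in 𝓝[>] (0 : ℝ), dist (meshPoint δ (nearestSite δ x₀)) x₀ ≤ δ := by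
      filter_upwards [hδpos] with δ hδ
      exact dist_meshPoint_nearestSite_le hδ x₀
    have htend : Tendsto (fun δ => meshPoint δ (nearestSite δ x₀)) (𝓝[>] 0) (𝓝 x₀) := by
      rw [tendsto_iff_dist_tendsto_zero]
      exact squeeze_zero' (Eventually.of_forall fun δ => dist_nonneg) hdist
        (tendsto_nhdsWithin_of_tendsto_nhds tendsto_id)
    have hmem : ∀ᶠ δ in 𝓝[>] (0 : ℝ), nearestSite δ x₀ ∈ meshDomain D.carrier δ := by
      filter_upwards [hV _ (isCompact_closedBall x₀ (η / 2)) hKD, hdist, hδlt] with δ hVδ hd hδη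
      exact hVδ _ (mem_closedBall.2 (hd.trans hδη.le))
    have hzH : ψ.symm x₀ ∈ upperHalfPlaneSet := ψ.symm_mapsTo hx₀
    have h1 := (H1q x₀ hx₀ _ htend hmem).eventually_ne (halfPlane_martinKernel_pos t hzH).ne'
    have h2 := (H1e x₀ hx₀ _ htend hmem).eventually_ne (halfPlane_martinKernel_pos r hzH).ne'
    filter_upwards [h1, h2] with δ h1 h2
    exact ⟨(div_ne_zero_iff.1 h1).2, (div_ne_zero_iff.1 h2).2⟩
  -- `H2` in the normalised form
  have H2' : ∀ ε > 0, ∃ ρ > 0, ∀ᶠ δ in 𝓝[>] 0, ∀ x x' : Site 2,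
      x ∈ meshDomain D.carrier δ → x' ∈ meshDomain D.carrier δ →
      dist (meshPoint δ x) u < ρ → dist (meshPoint δ x') u < ρ →
      |G δ x (q δ) / G δ (o δ) (q δ) / (G δ x (e δ) / G δ (o δ) (e δ)) /
          (G δ x' (q δ) / G δ (o δ) (q δ) / (G δ x' (e δ) / G δ (o δ) (e δ))) - 1| ≤ ε := by
    intro ε hε
    obtain ⟨ρ, hρ, hosc⟩ := H2 ε hε
    refine ⟨ρ, hρ, ?_⟩
    filter_upwards [hosc, hnz] with δ hoscδ hnzδ x x' hx hx' hdx hdx'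
    rw [div_div_div_div_normalisation hnzδ.1 hnzδ.2]
    exact hoscδ x x' hx hx' hdx hdx'
  exact tendsto_martinRatio_of_interiorLimit_of_ratioOscillation D ψ hst hu hs
    (fun δ => meshDomain D.carrier δ) hV
    (fun δ x => G δ x (q δ) / G δ (o δ) (q δ)) (fun δ x => G δ x (e δ) / G δ (o δ) (e δ))
    H1q H1e H2' p hp hpmem

/-- **`KozdronLawler2005_martinRatioBoundaryLimit` from the two Chelkak–Wan-type inputs for the
edge-killed walk.** If, for the walk run along `discreteDomainGraph D.carrier δ` and killed at its
first non-edge step, (H1) the lattice Martin kernel `G(·, q_δ)/G(o_δ, q_δ)` with a boundary-vertex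
pole `q_δ → v = ψ(t)` (`q_δ ∈ meshBoundary`), normalised at `o_δ → ψ(i)`, converges along lattice
approximants of every interior point `x` to `Im z (1 + t²)/|z − t|²`, `z = ψ⁻¹(x)` — the analogue
of Chelkak–Wan 2021, Cor. 3.6 (`Z(a^δ,u^δ)/Z(a^δ,v^δ) → P_Ω(a,u)/P_Ω(a,v)`, there for simply
connected induced subgraphs) —, and (H2) for boundary-vertex poles `q_δ → v`, `e_δ → w` and a third
boundary point `u ≠ v, w`, the ratio `G(·, q_δ)/G(·, e_δ)` oscillates by at most `ε` over the
vertices of `Ω_δ` with mesh point in `B(u, ρ(ε))`, for all small `δ` — the analogue of ibid.,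
Cor. 3.8 (uniform boundary Harnack principle; vertex form of the printed statement:
`ChelkakWan_uniformBoundaryHarnack`) —, then the named fact holds
(`tendsto_killedGreen_martinRatio_of_interiorLimit_of_ratioOscillation` at each datum). Neither
H1 nor H2 is asserted here: for this discretisation (largest mesh component, edge killing) they
are in no printed source, which is exactly the gap between Kozdron–Lawler's Prop. 3.10 /
Chelkak–Wan's §3 and the named fact. [cite: ChelkakWan2021, Cor. 3.6 and Cor. 3.8] -/
theorem KozdronLawler2005_martinRatioBoundaryLimit_of_martinKernelLimit_of_boundaryHarnack
    (H1 : ∀ (D : JordanDomain) (ψ : ConformalEquiv upperHalfPlaneSet D.carrier) (t : ℝ) (v : ℂ),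
      ψ.HasBoundaryValue t v → ∀ (q o : ℝ → Site 2),
      Tendsto (fun δ => meshPoint δ (q δ)) (𝓝[>] 0) (𝓝 v) →
      Tendsto (fun δ => meshPoint δ (o δ)) (𝓝[>] 0) (𝓝 (ψ Complex.I)) →
      (∀ᶠ δ in 𝓝[>] 0, q δ ∈ meshBoundary D.carrier δ ∧ o δ ∈ meshDomain D.carrier δ) →
      ∀ x ∈ D.carrier, ∀ xs : ℝ → Site 2,
      Tendsto (fun δ => meshPoint δ (xs δ)) (𝓝[>] 0) (𝓝 x) →
      (∀ᶠ δ in 𝓝[>] 0, xs δ ∈ meshDomain D.carrier δ) →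
      Tendsto (fun δ => SRW.killedGreen (discreteDomainGraph D.carrier δ) (xs δ) (q δ) /
          SRW.killedGreen (discreteDomainGraph D.carrier δ) (o δ) (q δ)) (𝓝[>] 0)
        (𝓝 ((ψ.symm x).im * (1 + t ^ 2) / ‖ψ.symm x - t‖ ^ 2)))
    (H2 : ∀ (D : JordanDomain) (u v w : ℂ), u ∈ frontier D.carrier → u ≠ v → u ≠ w →
      ∀ (q e : ℝ → Site 2),
      Tendsto (fun δ => meshPoint δ (q δ)) (𝓝[>] 0) (𝓝 v) →
      Tendsto (fun δ => meshPoint δ (e δ)) (𝓝[>] 0) (𝓝 w) →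
      (∀ᶠ δ in 𝓝[>] 0, q δ ∈ meshBoundary D.carrier δ ∧ e δ ∈ meshBoundary D.carrier δ) →
      ∀ ε > 0, ∃ ρ > 0, ∀ᶠ δ in 𝓝[>] 0, ∀ x x' : Site 2,
      x ∈ meshDomain D.carrier δ → x' ∈ meshDomain D.carrier δ →
      dist (meshPoint δ x) u < ρ → dist (meshPoint δ x') u < ρ →
      |SRW.killedGreen (discreteDomainGraph D.carrier δ) x (q δ) /
            SRW.killedGreen (discreteDomainGraph D.carrier δ) x (e δ) /
          (SRW.killedGreen (discreteDomainGraph D.carrier δ) x' (q δ) /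
            SRW.killedGreen (discreteDomainGraph D.carrier δ) x' (e δ)) - 1| ≤ ε) :
    KozdronLawler2005_martinRatioBoundaryLimit := by
  intro D ψ s t r u v w hst _hsr _htr huv huw _hvw hu _hv _hw hs ht hr p q e o hp hq he ho hmem
  refine tendsto_killedGreen_martinRatio_of_interiorLimit_of_ratioOscillation D ψ hst hu hs
    p q e o hp (hmem.mono fun δ h => h.1) ?_ ?_ ?_
  · exact H1 D ψ t v ht q o hq ho (hmem.mono fun δ h => ⟨h.2.1, h.2.2.2⟩)
  · exact H1 D ψ r w hr e o he ho (hmem.mono fun δ h => ⟨h.2.2.1, h.2.2.2⟩)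
  · exact H2 D u v w hu huv huw q e hq he (hmem.mono fun δ h => ⟨h.2.1, h.2.2.1⟩)

end ChelkakWanInputs

/-! ### The fact from interior Green convergence (GC) and the uniform boundary Harnack
### principle (UBHP) for the edge-killed walk

Fourth session of the provefact seat (2026-08-16). The crux `SAWLoopFugacityFlow.AvoidanceLimit`
of `Summits/CriticalPhenomena/SAWScalingLimit` (line `symplectic-fermion-anchor`) isolates, for
the SAME walk (`discreteDomainGraph D δ`, edge killing; its `greenEntry` is `SRW.killedGreen` by
`…AvoidanceLimitGreenConvergenceBridge.lean`), exactly two lattice inputs: (GC) interior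
convergence of the killed Green function, `G(x_δ, y_δ) → c · G_ℍ(ψ⁻¹x, ψ⁻¹y)` for distinct
interior `x, y` (`…InteriorRatioLimitReduction.lean`; being proved there by sandwiching the
edge-killed walk between the vertex-killed walks of an inner and an outer simply connected
lattice approximation, `SRW.killedGreen_mono` + `killedGreen_tendsto_of_kernelConvergence`), and
(UBHP) the uniform boundary Harnack principle at a marked prime end in Euclidean balls,
division-free (`…RatioOscillationReduction.lean`). The theorems of this section PROVE that the
named fact follows from these two inputs alone (both stated as hypotheses, universally over
Jordan domains; neither is asserted):

* `tendsto_halfPlaneGreen_ratio` — continuum: `G_ℍ(w, z)/G_ℍ(w, z') → [Im z/|t − z|²]/[Im z'/|t − z'|²]`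
  as `w → t ∈ ℝ` inside `ℍ` (`G_ℍ(w, z) = ½ log(1 + 4 Im w Im z/|w − z|²)` and `log(1 + a) ∼ a`):
  the Martin kernel of `ℍ` at `t` as the boundary limit of Green-function ratios;
* `JordanDomain.eventually_killedGreen_pos`, `killedGreen_discreteDomainGraph_harmonic` —
  lattice bookkeeping: `Ω_δ` is eventually one piece (so `G > 0` on it), and `G(·, q)` is
  harmonic for the killed walk off `q` (first-step equation);
* `killedGreen_ratioOscillation_of_uniformBHP` — `H2` of the previous section from (UBHP) at `u`;
* `killedGreen_martinKernelLimit_of_greenConvergence_of_uniformBHP` — `H1` of the previous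
  section from (GC) + (UBHP) at `v`: by symmetry `G(x_δ, q_δ)/G(o_δ, q_δ) = G(q_δ, x_δ)/G(q_δ, o_δ)`;
  (UBHP) at `v` moves the evaluation point `q_δ` (at the boundary) to the approximants of an
  interior point `y` near `v` at the cost of a factor `(1 + ε)^{±1}`; (GC) twice turns the ratio
  at `y` into `G_ℍ(ψ⁻¹y, ψ⁻¹x)/G_ℍ(ψ⁻¹y, i)`, which is `ε`-close to `Im z (1+t²)/|z − t|²` for `y`
  close to `v` (Carathéodory + the first bullet);
* `KozdronLawler2005_martinRatioBoundaryLimit_of_greenConvergence_of_uniformBHP` — the named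
  fact from (GC) and (UBHP), through
  `KozdronLawler2005_martinRatioBoundaryLimit_of_martinKernelLimit_of_boundaryHarnack`.

So the residue of the named fact is precisely {(GC), (UBHP)} for the edge-killed walk — the two
statement-level obligations of that crux —, of which (GC) rests on the printed, vertex-killed
Chelkak–Wan Cor. 3.3 (`killedGreen_tendsto_of_kernelConvergence`) plus a monotonicity sandwich,
and (UBHP) (Chelkak–Wan Lemma 3.7/Cor. 3.8 transported to edge killing and Euclidean balls) is in
no printed source.
-/

section GreenConvergenceInputs

open _root_.Metric _root_.Set
open scoped Classical

/-! #### Continuum input: the half-plane Green function seen from a boundary point -/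

/-- `‖w − z̄‖² = ‖w − z‖² + 4 Im w Im z`: the identity behind
`G_ℍ(w, z) = log(‖w − z̄‖/‖w − z‖) = ½ log(1 + 4 Im w Im z/‖w − z‖²)` (a `private` copy of
`norm_sub_conj_sq` of `PlanarIsingBoundaryDecorrelation.lean`, not imported here). [folklore] -/
private theorem norm_sub_conj_sq' (w z : ℂ) :
    ‖w - (starRingEnd ℂ) z‖ ^ 2 = ‖w - z‖ ^ 2 + 4 * w.im * z.im := by
  rw [Complex.sq_norm, Complex.sq_norm, Complex.normSq_apply, Complex.normSq_apply]
  simp only [Complex.sub_re, Complex.sub_im, Complex.conj_re, Complex.conj_im]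
  ring

/-- The half-plane Green function `G_ℍ(w, z) = log(‖w − z̄‖/‖w − z‖)` is positive for `w ≠ z`
in `ℍ`. [folklore] -/
theorem halfPlaneGreen_pos {w z : ℂ} (hw : 0 < w.im) (hz : 0 < z.im) (hwz : w ≠ z) :
    0 < Real.log (‖w - (starRingEnd ℂ) z‖ / ‖w - z‖) := by
  have hn : 0 < ‖w - z‖ := norm_pos_iff.2 (sub_ne_zero.2 hwz)
  refine Real.log_pos ((one_lt_div hn).2 ?_)
  have h2 := norm_sub_conj_sq' w z
  have h4 : 0 < 4 * w.im * z.im := by positivity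
  nlinarith [norm_nonneg (w - (starRingEnd ℂ) z), norm_nonneg (w - z)]

/-- `G_ℍ(w, z) = ½ log(1 + 4 Im w Im z/‖w − z‖²)` for `w ≠ z`. [folklore] -/
theorem halfPlaneGreen_eq_half_log {w z : ℂ} (hwz : w ≠ z) :
    Real.log (‖w - (starRingEnd ℂ) z‖ / ‖w - z‖) =
      2⁻¹ * Real.log (1 + 4 * w.im * z.im / ‖w - z‖ ^ 2) := by
  have hn : 0 < ‖w - z‖ := norm_pos_iff.2 (sub_ne_zero.2 hwz)
  have hsq : (‖w - (starRingEnd ℂ) z‖ / ‖w - z‖) ^ 2 = 1 + 4 * w.im * z.im / ‖w - z‖ ^ 2 := by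
    rw [div_pow, norm_sub_conj_sq']
    field_simp
  rw [← hsq, Real.log_pow]
  ring

/-- `log(1 + a)/a → 1` as `a → 0`, `a ≠ 0` (the derivative of `log` at `1`). [folklore] -/
theorem tendsto_log_one_add_div_self :
    Tendsto (fun a : ℝ => Real.log (1 + a) / a) (𝓝[≠] 0) (𝓝 1) := by
  have h := (Real.hasDerivAt_log (one_ne_zero)).tendsto_slope_zero
  simp only [Real.log_one, sub_zero, smul_eq_mul, inv_one] at h
  refine h.congr' ?_
  filter_upwards [self_mem_nhdsWithin] with a _
  rw [div_eq_inv_mul]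

/-- **The half-plane Green function seen from a boundary point is the Poisson kernel, in ratio
form.** For `z, z' ∈ ℍ` and `t ∈ ℝ`, as `w → t` inside `ℍ`,
`G_ℍ(w, z)/G_ℍ(w, z') → [Im z/|t − z|²]/[Im z'/|t − z'|²]`, `G_ℍ(w, z) = log(|w − z̄|/|w − z|)`:
from `G_ℍ(w, z) = ½ log(1 + 4 Im w Im z/|w − z|²)`, `log(1 + a) ∼ a`, the factor `4 Im w`
cancelling in the ratio. This is the continuum Martin kernel of `ℍ` at the boundary point `t`
(the limit `g(y, ·)/g(y, o) → K_t/K_t(o)` as `y → t`, no tangential restriction).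
[cite: ChelkakWan2021, Prop. 3.5 and Cor. 3.6 (continuum side)] -/
theorem tendsto_halfPlaneGreen_ratio (t : ℝ) {z z' : ℂ} (hz : 0 < z.im) (hz' : 0 < z'.im) :
    Tendsto (fun w : ℂ => Real.log (‖w - (starRingEnd ℂ) z‖ / ‖w - z‖) /
        Real.log (‖w - (starRingEnd ℂ) z'‖ / ‖w - z'‖))
      (𝓝[upperHalfPlaneSet] (t : ℂ))
      (𝓝 (z.im / ‖(t : ℂ) - z‖ ^ 2 / (z'.im / ‖(t : ℂ) - z'‖ ^ 2))) := by
  -- abbreviations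
  set A : ℂ → ℝ := fun w => 4 * w.im * z.im / ‖w - z‖ ^ 2 with hA
  set A' : ℂ → ℝ := fun w => 4 * w.im * z'.im / ‖w - z'‖ ^ 2 with hA'
  set φ : ℝ → ℝ := fun a => Real.log (1 + a) / a with hφ
  set Rt : ℂ → ℝ := fun w => z.im / ‖w - z‖ ^ 2 / (z'.im / ‖w - z'‖ ^ 2) with hRt
  have htz : (t : ℂ) ≠ z := fun h => by
    have := congrArg Complex.im h
    simp only [Complex.ofReal_im] at this
    linarith
  have htz' : (t : ℂ) ≠ z' := fun h => by
    have := congrArg Complex.im h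
    simp only [Complex.ofReal_im] at this
    linarith
  have hnz : ‖(t : ℂ) - z‖ ^ 2 ≠ 0 := pow_ne_zero 2 (norm_ne_zero_iff.2 (sub_ne_zero.2 htz))
  have hnz' : ‖(t : ℂ) - z'‖ ^ 2 ≠ 0 := pow_ne_zero 2 (norm_ne_zero_iff.2 (sub_ne_zero.2 htz'))
  -- eventually `w ∈ ℍ`, `w ≠ z`, `w ≠ z'`
  have hev : ∀ᶠ w in 𝓝[upperHalfPlaneSet] (t : ℂ), 0 < w.im ∧ w ≠ z ∧ w ≠ z' := by
    filter_upwards [self_mem_nhdsWithin, mem_nhdsWithin_of_mem_nhds (isOpen_ne.mem_nhds htz),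
      mem_nhdsWithin_of_mem_nhds (isOpen_ne.mem_nhds htz')] with w hw hwz hwz'
    exact ⟨hw, hwz, hwz'⟩
  -- `A, A' → 0` within `{a ≠ 0}`
  have hA0 : Tendsto A (𝓝[upperHalfPlaneSet] (t : ℂ)) (𝓝[≠] 0) := by
    refine tendsto_nhdsWithin_iff.2 ⟨?_, ?_⟩
    · have hc : ContinuousAt A t := by
        simp only [hA]
        exact ((continuous_const.mul Complex.continuous_im).mul continuous_const).continuousAt.div
          (by fun_prop) hnz
      have hAt : A t = 0 := by simp [hA]
      simpa [hAt] using hc.tendsto.mono_left nhdsWithin_le_nhds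
    · filter_upwards [hev] with w hw
      have hn : 0 < ‖w - z‖ := norm_pos_iff.2 (sub_ne_zero.2 hw.2.1)
      have : 0 < A w := by simp only [hA]; have := hw.1; positivity
      exact this.ne'
  have hA0' : Tendsto A' (𝓝[upperHalfPlaneSet] (t : ℂ)) (𝓝[≠] 0) := by
    refine tendsto_nhdsWithin_iff.2 ⟨?_, ?_⟩
    · have hc : ContinuousAt A' t := by
        simp only [hA']
        exact ((continuous_const.mul Complex.continuous_im).mul continuous_const).continuousAt.div
          (by fun_prop) hnz'
      have hAt : A' t = 0 := by simp [hA']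
      simpa [hAt] using hc.tendsto.mono_left nhdsWithin_le_nhds
    · filter_upwards [hev] with w hw
      have hn : 0 < ‖w - z'‖ := norm_pos_iff.2 (sub_ne_zero.2 hw.2.2)
      have : 0 < A' w := by simp only [hA']; have := hw.1; positivity
      exact this.ne'
  have hφA : Tendsto (fun w => φ (A w)) (𝓝[upperHalfPlaneSet] (t : ℂ)) (𝓝 1) :=
    tendsto_log_one_add_div_self.comp hA0
  have hφA' : Tendsto (fun w => φ (A' w)) (𝓝[upperHalfPlaneSet] (t : ℂ)) (𝓝 1) :=
    tendsto_log_one_add_div_self.comp hA0'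
  -- the ratio of the Poisson-type kernels is continuous at `t`
  have hR : Tendsto Rt (𝓝[upperHalfPlaneSet] (t : ℂ)) (𝓝 (Rt t)) := by
    have hc : ContinuousAt Rt t := by
      simp only [hRt]
      have h1 : ContinuousAt (fun w : ℂ => z.im / ‖w - z‖ ^ 2) t :=
        continuousAt_const.div (by fun_prop) hnz
      have h2 : ContinuousAt (fun w : ℂ => z'.im / ‖w - z'‖ ^ 2) t :=
        continuousAt_const.div (by fun_prop) hnz'
      exact h1.div h2 (div_ne_zero hz'.ne' hnz')
    exact hc.tendsto.mono_left nhdsWithin_le_nhds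
  have hlim : Tendsto (fun w => φ (A w) / φ (A' w) * Rt w) (𝓝[upperHalfPlaneSet] (t : ℂ))
      (𝓝 (z.im / ‖(t : ℂ) - z‖ ^ 2 / (z'.im / ‖(t : ℂ) - z'‖ ^ 2))) := by
    have := (hφA.div hφA' one_ne_zero).mul hR
    simpa [hRt] using this
  refine hlim.congr' ?_
  filter_upwards [hev] with w hw
  obtain ⟨hwim, hwz, hwz'⟩ := hw
  have hn : 0 < ‖w - z‖ := norm_pos_iff.2 (sub_ne_zero.2 hwz)
  have hn' : 0 < ‖w - z'‖ := norm_pos_iff.2 (sub_ne_zero.2 hwz')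
  have hApos : 0 < A w := by simp only [hA]; positivity
  have hA'pos : 0 < A' w := by simp only [hA']; positivity
  have hlog' : Real.log (1 + A' w) ≠ 0 := (Real.log_pos (by linarith)).ne'
  rw [halfPlaneGreen_eq_half_log hwz, halfPlaneGreen_eq_half_log hwz']
  simp only [hφ, hRt, hA, hA'] at hApos hA'pos hlog' ⊢
  have him : w.im ≠ 0 := hwim.ne'
  have hzim : z.im ≠ 0 := hz.ne'
  have hz'im : z'.im ≠ 0 := hz'.ne'
  field_simp

/-- Boundary values of `ψ : ℍ → D` at real points are boundary points of `D`: if `ψ w → v` as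
`w → t ∈ ℝ` inside `ℍ`, then `v ∈ ∂D` (were `v ∈ D`, continuity of `ψ⁻¹` at `v` would force
`ψ⁻¹ v = t ∈ ℍ`). [folklore] -/
theorem mem_frontier_of_hasBoundaryValue_real (D : JordanDomain)
    (ψ : ConformalEquiv upperHalfPlaneSet D.carrier) {t : ℝ} {v : ℂ}
    (ht : ψ.HasBoundaryValue t v) : v ∈ frontier D.carrier := by
  haveI : (𝓝[upperHalfPlaneSet] (t : ℂ)).NeBot := by
    refine mem_closure_iff_nhdsWithin_neBot.1 ?_
    rw [UpperHalfPlane.upperHalfPlaneSet, Complex.closure_setOf_lt_im]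
    simp
  have hcl : v ∈ closure D.carrier :=
    mem_closure_of_tendsto ht (eventually_nhdsWithin_of_forall fun w hw => ψ.mapsTo hw)
  rw [closure_eq_interior_union_frontier, D.isOpen.interior_eq] at hcl
  refine hcl.resolve_left fun hvD => ?_
  have hcont : ContinuousAt ψ.symm v :=
    (ψ.symm.continuousOn v hvD).continuousAt (D.isOpen.mem_nhds hvD)
  have h1 : Tendsto (fun w => ψ.symm (ψ w)) (𝓝[upperHalfPlaneSet] (t : ℂ)) (𝓝 (ψ.symm v)) :=
    hcont.tendsto.comp ht
  have h2 : Tendsto (fun w => ψ.symm (ψ w)) (𝓝[upperHalfPlaneSet] (t : ℂ)) (𝓝 (t : ℂ)) :=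
    (tendsto_nhdsWithin_of_tendsto_nhds tendsto_id).congr'
      (eventually_nhdsWithin_of_forall fun w hw => (ψ.symm_apply_apply hw).symm)
  have heq := tendsto_nhds_unique h1 h2
  have hmem : ψ.symm v ∈ upperHalfPlaneSet := ψ.symm_mapsTo hvD
  rw [heq] at hmem
  have : (0 : ℝ) < (t : ℂ).im := hmem
  simp at this

/-! #### Lattice preliminaries: `Ω_δ` is eventually one piece, so `G > 0` on it -/

/-- `Ω_δ` is a union of whole mesh components (cf. `mem_meshDomain_of_reachable_meshVertexGraph`
of `MeshDomainBigComponents.lean`, re-proved here to keep the imports light). [folklore] -/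
private theorem mem_meshDomain_of_adj' {Ω : Set ℂ} {δ : ℝ} {a b : meshVertices Ω δ}
    (ha : (a : Site 2) ∈ meshDomain Ω δ) (h : (meshVertexGraph Ω δ).Adj a b) :
    (b : Site 2) ∈ meshDomain Ω δ := by
  simp only [meshDomain, mem_iUnion, mem_image] at ha ⊢
  obtain ⟨C, hC, a', ha'C, ha'a⟩ := ha
  have haa' : a' = a := Subtype.ext ha'a
  subst haa'
  refine ⟨C, hC, b, ?_, rfl⟩
  rw [SimpleGraph.ConnectedComponent.mem_supp_iff] at ha'C ⊢
  rw [← ha'C]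
  exact SimpleGraph.ConnectedComponent.sound h.symm.reachable

/-- A walk of the mesh graph on mesh vertices starting in `Ω_δ` is a walk of
`discreteDomainGraph Ω δ` (cf. `reachable_discreteDomainGraph_of_walk` of
`SAWScalingLimitFamily.lean`, re-proved here to keep the imports light). [folklore] -/
private theorem reachable_discreteDomainGraph_of_walk' {Ω : Set ℂ} {δ : ℝ}
    {u w : meshVertices Ω δ} (p : (meshVertexGraph Ω δ).Walk u w)
    (hu : (u : Site 2) ∈ meshDomain Ω δ) : (discreteDomainGraph Ω δ).Reachable u w := by
  induction p with
  | nil => rfl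
  | @cons a b c hadj p ih =>
    have hb : (b : Site 2) ∈ meshDomain Ω δ := mem_meshDomain_of_adj' hu hadj
    have hadj' : (meshGraph Ω δ).Adj a b := by
      simpa only [SimpleGraph.comap_adj, Function.Embedding.subtype_apply] using hadj
    exact (discreteDomainGraph_adj_iff.2 ⟨hadj', hu, hb⟩).reachable.trans (ih hb)

/-- **`Ω_δ` is eventually one piece: the killed Green function is positive on it.** For a Jordan
domain `D`, for all small `δ > 0`, any two vertices of `Ω_δ = meshDomain D δ` are joined in
`discreteDomainGraph D δ` (`JordanDomain.eventually_forall_mem_meshDomain'`), so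
`G(x, y) = SRW.killedGreen (discreteDomainGraph D δ) x y > 0` (`SRW.killedGreen_pos_of_reachable`).
[folklore] -/
theorem _root_.Literature.Probability.RandomPlanarGeometry.JordanDomain.eventually_killedGreen_pos
    (D : JordanDomain) :
    ∀ᶠ δ in 𝓝[>] (0 : ℝ), ∀ x ∈ meshDomain D.carrier δ, ∀ y ∈ meshDomain D.carrier δ,
      0 < SRW.killedGreen (discreteDomainGraph D.carrier δ) x y := by
  obtain ⟨x₀, hx₀⟩ := D.isConnected.nonempty
  have hKD : ({x₀} : Set ℂ) ⊆ D.carrier := singleton_subset_iff.2 hx₀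
  filter_upwards [D.eventually_forall_mem_meshDomain' isCompact_singleton hKD,
    self_mem_nhdsWithin] with δ hδ hpos x hx y hy
  obtain ⟨hxv, hyv, ⟨p⟩⟩ := hδ.2 x hx y hy
  exact SRW.killedGreen_pos_of_reachable
    ((discreteDomainGraph_le_meshGraph _ _).trans (meshGraph_le_zdGraph _ _))
    (SRW.finite_support_discreteDomainGraph D.isBounded hpos)
    (reachable_discreteDomainGraph_of_walk' p hx)

/-- **`G(·, q)` is harmonic for the killed walk off its pole** (first-step equation of
`SRW.killedGreen` on the finite graph `Ω_δ`, `d = 2`): for `z ≠ q`,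
`G(z, q) = ¼ Σ_e [z ∼ z + e in Ω_δ] G(z + e, q)`. [folklore] -/
theorem killedGreen_discreteDomainGraph_harmonic {Ω : Set ℂ} (hΩ : Bornology.IsBounded Ω)
    {δ : ℝ} (hδ : 0 < δ) {z q : Site 2} (hzq : z ≠ q) :
    SRW.killedGreen (discreteDomainGraph Ω δ) z q = 4⁻¹ * ∑ e : SRW.Dir 2,
      if (discreteDomainGraph Ω δ).Adj z (z + SRW.stepVec e) then
        SRW.killedGreen (discreteDomainGraph Ω δ) (z + SRW.stepVec e) q else 0 := by
  rw [SRW.killedGreen_first_step_of_finite_support (SRW.finite_support_discreteDomainGraph hΩ hδ),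
    if_neg hzq]
  norm_num

/-! #### H2 — ratio oscillation at `u` — from the uniform boundary Harnack principle -/

/-- Two-sided multiplicative closeness gives closeness of the quotient to `1`:
`P ≤ (1+ε)Q`, `Q ≤ (1+ε)P`, `P, Q > 0` `⟹ |P/Q − 1| ≤ ε`. [folklore] -/
private theorem abs_div_sub_one_le_of_mul_le {P Q ε : ℝ} (hP : 0 < P) (hQ : 0 < Q) (hε : 0 ≤ ε)
    (h1 : P ≤ (1 + ε) * Q) (h2 : Q ≤ (1 + ε) * P) : |P / Q - 1| ≤ ε := by
  rw [abs_sub_le_iff]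
  constructor
  · rw [sub_le_iff_le_add, div_le_iff₀ hQ]
    linarith
  · rw [sub_le_comm, le_div_iff₀ hQ]
    rcases le_or_gt ε 1 with hε1 | hε1
    · nlinarith
    · nlinarith

/-- **H2 from (UBHP).** `D` a Jordan domain; (UBHP) the uniform boundary Harnack principle for
the edge-killed walk on `Ω_δ = discreteDomainGraph D δ` at the boundary points of `D`, in
Euclidean balls and division-free form: for `b ∈ ∂D`, `R > 0`, `η > 0` there is `r > 0` such
that for all small `δ`, any two nonnegative lattice functions `h₁, h₂` harmonic for the killed
walk at the vertices of `Ω_δ` within `R` of `b` (`h(z) = ¼ Σ_e [z ∼ z+e in Ω_δ] h(z+e)`: the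
killed steps carry the zero boundary values) satisfy `h₁(z) h₂(z') ≤ (1 + η) h₁(z') h₂(z)` for
all `z, z' ∈ Ω_δ` within `r` of `b` — the analogue for this discretisation of Chelkak–Wan 2021,
Cor. 3.8 (there: induced simply connected subgraphs, inner balls; vertex form in the tree:
`ChelkakWan_uniformBoundaryHarnack`), and verbatim the input (UBHP) isolated by
`Summits/CriticalPhenomena/SAWScalingLimit/Theorems/SAWLoopFugacityFlowAvoidanceLimitRatioOscillationReduction.lean`
for the edge-killed walk. Conclusion: hypothesis `H2` of
`KozdronLawler2005_martinRatioBoundaryLimit_of_martinKernelLimit_of_boundaryHarnack` — for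
boundary-vertex poles `q_δ → v`, `e_δ → w` and `u ∈ ∂D ∖ {v, w}`, the ratio `G(·, q_δ)/G(·, e_δ)`
oscillates by at most `ε` over the vertices of `Ω_δ` within `ρ(ε)` of `u`, for all small `δ`.
Proof: `G(·, q_δ)`, `G(·, e_δ)` are nonnegative and harmonic for the killed walk within
`R = min(|u − v|, |u − w|)/2` of `u` once the poles are `R`-close to `v`, `w`
(`killedGreen_discreteDomainGraph_harmonic`), and positive on `Ω_δ`
(`JordanDomain.eventually_killedGreen_pos`); (UBHP) at `u` with `η = ε` both ways round gives
`|[G(x,q)G(x',e)]/[G(x,e)G(x',q)] − 1| ≤ ε`. [cite: ChelkakWan2021, Cor. 3.8] -/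
theorem killedGreen_ratioOscillation_of_uniformBHP (D : JordanDomain)
    (hBHP : ∀ b ∈ frontier D.carrier, ∀ R > (0 : ℝ), ∀ η > (0 : ℝ), ∃ r > (0 : ℝ),
      ∀ᶠ δ in 𝓝[>] (0 : ℝ), ∀ h₁ h₂ : Site 2 → ℝ, (∀ z, 0 ≤ h₁ z) → (∀ z, 0 ≤ h₂ z) →
        (∀ z ∈ meshDomain D.carrier δ, dist (meshPoint δ z) b < R →
          h₁ z = 4⁻¹ * ∑ e : SRW.Dir 2,
            if (discreteDomainGraph D.carrier δ).Adj z (z + SRW.stepVec e)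
            then h₁ (z + SRW.stepVec e) else 0) →
        (∀ z ∈ meshDomain D.carrier δ, dist (meshPoint δ z) b < R →
          h₂ z = 4⁻¹ * ∑ e : SRW.Dir 2,
            if (discreteDomainGraph D.carrier δ).Adj z (z + SRW.stepVec e)
            then h₂ (z + SRW.stepVec e) else 0) →
        ∀ z z' : Site 2, z ∈ meshDomain D.carrier δ → z' ∈ meshDomain D.carrier δ →
          dist (meshPoint δ z) b < r → dist (meshPoint δ z') b < r →
          h₁ z * h₂ z' ≤ (1 + η) * (h₁ z' * h₂ z))
    {u v w : ℂ} (hu : u ∈ frontier D.carrier) (huv : u ≠ v) (huw : u ≠ w) (q e : ℝ → Site 2)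
    (hq : Tendsto (fun δ => meshPoint δ (q δ)) (𝓝[>] 0) (𝓝 v))
    (he : Tendsto (fun δ => meshPoint δ (e δ)) (𝓝[>] 0) (𝓝 w))
    (hmem : ∀ᶠ δ in 𝓝[>] 0, q δ ∈ meshBoundary D.carrier δ ∧ e δ ∈ meshBoundary D.carrier δ) :
    ∀ ε > 0, ∃ ρ > 0, ∀ᶠ δ in 𝓝[>] 0, ∀ x x' : Site 2,
      x ∈ meshDomain D.carrier δ → x' ∈ meshDomain D.carrier δ →
      dist (meshPoint δ x) u < ρ → dist (meshPoint δ x') u < ρ →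
      |SRW.killedGreen (discreteDomainGraph D.carrier δ) x (q δ) /
            SRW.killedGreen (discreteDomainGraph D.carrier δ) x (e δ) /
          (SRW.killedGreen (discreteDomainGraph D.carrier δ) x' (q δ) /
            SRW.killedGreen (discreteDomainGraph D.carrier δ) x' (e δ)) - 1| ≤ ε := by
  intro ε hε
  -- radius of harmonicity: the poles stay `R`-away from `u`
  have hvu : 0 < dist v u := dist_pos.2 huv.symm
  have hwu : 0 < dist w u := dist_pos.2 huw.symm
  set R : ℝ := min (dist v u) (dist w u) / 2 with hR
  have hR0 : 0 < R := by positivity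
  have hRv : 2 * R ≤ dist v u := by
    simp only [hR]; linarith [min_le_left (dist v u) (dist w u)]
  have hRw : 2 * R ≤ dist w u := by
    simp only [hR]; linarith [min_le_right (dist v u) (dist w u)]
  obtain ⟨r, hr, hB⟩ := hBHP u hu R hR0 ε hε
  refine ⟨r, hr, ?_⟩
  have hδpos : ∀ᶠ δ in 𝓝[>] (0 : ℝ), 0 < δ := self_mem_nhdsWithin
  have hqfar : ∀ᶠ δ in 𝓝[>] (0 : ℝ), R < dist (meshPoint δ (q δ)) u := by
    filter_upwards [Metric.tendsto_nhds.1 hq R hR0] with δ hδ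
    rw [dist_comm] at hδ
    linarith [dist_triangle v (meshPoint δ (q δ)) u]
  have hefar : ∀ᶠ δ in 𝓝[>] (0 : ℝ), R < dist (meshPoint δ (e δ)) u := by
    filter_upwards [Metric.tendsto_nhds.1 he R hR0] with δ hδ
    rw [dist_comm] at hδ
    linarith [dist_triangle w (meshPoint δ (e δ)) u]
  filter_upwards [hB, D.eventually_killedGreen_pos, hmem, hδpos, hqfar, hefar] with δ hBδ hpos
    hmemδ hδ hqδ heδ x x' hx hx' hxu hx'u
  -- harmonicity within `R` of `u` of `G(·, p)` for a pole `p` at distance `> R` from `u`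
  have harm : ∀ p : Site 2, R < dist (meshPoint δ p) u → ∀ z ∈ meshDomain D.carrier δ,
      dist (meshPoint δ z) u < R → SRW.killedGreen (discreteDomainGraph D.carrier δ) z p =
        4⁻¹ * ∑ e' : SRW.Dir 2, if (discreteDomainGraph D.carrier δ).Adj z (z + SRW.stepVec e')
          then SRW.killedGreen (discreteDomainGraph D.carrier δ) (z + SRW.stepVec e') p else 0 := by
    intro p hp z _ hz
    have hzp : z ≠ p := by rintro rfl; linarith
    exact killedGreen_discreteDomainGraph_harmonic D.isBounded hδ hzp
  have h1 := hBδ (fun z => SRW.killedGreen (discreteDomainGraph D.carrier δ) z (q δ))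
    (fun z => SRW.killedGreen (discreteDomainGraph D.carrier δ) z (e δ))
    (fun z => SRW.killedGreen_nonneg _ _ _) (fun z => SRW.killedGreen_nonneg _ _ _)
    (harm _ hqδ) (harm _ heδ) x x' hx hx' hxu hx'u
  have h2 := hBδ (fun z => SRW.killedGreen (discreteDomainGraph D.carrier δ) z (q δ))
    (fun z => SRW.killedGreen (discreteDomainGraph D.carrier δ) z (e δ))
    (fun z => SRW.killedGreen_nonneg _ _ _) (fun z => SRW.killedGreen_nonneg _ _ _)
    (harm _ hqδ) (harm _ heδ) x' x hx' hx hx'u hxu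
  have hqm : q δ ∈ meshDomain D.carrier δ := meshBoundary_subset_meshDomain _ _ hmemδ.1
  have hem : e δ ∈ meshDomain D.carrier δ := meshBoundary_subset_meshDomain _ _ hmemδ.2
  have ha := hpos x hx (q δ) hqm
  have hb := hpos x hx (e δ) hem
  have ha' := hpos x' hx' (q δ) hqm
  have hb' := hpos x' hx' (e δ) hem
  rw [div_div_div_eq]
  refine abs_div_sub_one_le_of_mul_le (mul_pos ha hb') (mul_pos hb ha') hε.le ?_ ?_
  · calc _ ≤ _ := h1
      _ = _ := by ring
  · calc _ = _ := by ring
      _ ≤ _ := h2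
      _ = _ := by ring

/-- The real-variable endgame of `killedGreen_martinKernelLimit_of_greenConvergence_of_uniformBHP`:
`M, Rt ≥ 0` within a factor `(1+ε)^{±1}` of each other, `|Rt − Q| < ε`, `|Q − K| < ε`,
`ε ≤ 1` `⟹ |M − K| ≤ (2K + 6) ε`. [folklore] -/
private theorem abs_sub_le_of_mul_close {M Rt Q K ε : ℝ} (hε : 0 < ε) (hε1 : ε ≤ 1)
    (hM1 : M ≤ (1 + ε) * Rt) (hM2 : Rt ≤ (1 + ε) * M) (hRtnn : 0 ≤ Rt)
    (hQK : |Q - K| < ε) (hRQ : |Rt - Q| < ε) : |M - K| ≤ (2 * K + 6) * ε := by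
  have hRt_bd : Rt ≤ K + 2 := by linarith [(abs_lt.1 hQK).2, (abs_lt.1 hRQ).2]
  have hεRt : ε * Rt ≤ ε * (K + 2) := mul_le_mul_of_nonneg_left hRt_bd hε.le
  have h1ε : 0 ≤ (1 - ε) * Rt := mul_nonneg (sub_nonneg.2 hε1) hRtnn
  have hM_bd : M ≤ 2 * (K + 2) := by nlinarith
  have hεM : ε * M ≤ ε * (2 * (K + 2)) := mul_le_mul_of_nonneg_left hM_bd hε.le
  have hMR : |M - Rt| ≤ 2 * ε * (K + 2) := by
    rw [abs_sub_le_iff]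
    constructor
    · nlinarith
    · nlinarith
  calc |M - K| = |(M - Rt) + (Rt - Q) + (Q - K)| := by ring_nf
    _ ≤ |(M - Rt) + (Rt - Q)| + |Q - K| := abs_add_le _ _
    _ ≤ |M - Rt| + |Rt - Q| + |Q - K| := by
        have := abs_add_le (M - Rt) (Rt - Q); linarith
    _ ≤ 2 * ε * (K + 2) + ε + ε := by linarith [hQK.le, hRQ.le]
    _ = (2 * K + 6) * ε := by ring

/-! #### H1 — interior limit of the lattice Martin kernel with a boundary-vertex pole — from
#### interior Green convergence (GC) and the uniform boundary Harnack principle at `v` -/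

/-- **H1 from (GC) + (UBHP).** `D` a Jordan domain, `ψ : ℍ → D` conformal.
(GC) — interior convergence of the Green function of the edge-killed walk, the analogue for
`Ω_δ = discreteDomainGraph D δ` of Chelkak–Wan 2021, Cor. 3.3 (vertex-killed, in the tree as
the fact `killedGreen_tendsto_of_kernelConvergence`), and verbatim the input (GC) isolated by
`Summits/CriticalPhenomena/SAWScalingLimit/Theorems/SAWLoopFugacityFlowAvoidanceLimitInteriorRatioLimitReduction.lean`
(at `D' = D`, through the bridge `greenEntry = SRW.killedGreen`): for some `c > 0`
(`c = 2/π` for the expected number of visits; only `c > 0` is used), for distinct `x, y ∈ D`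
and lattice families `x_δ → x`, `y_δ → y` in `Ω_δ`,
`G(x_δ, y_δ) → c · G_ℍ(ψ⁻¹x, ψ⁻¹y)`, `G_ℍ(a, b) = log(|a − b̄|/|a − b|)`.
(UBHP) — as in `killedGreen_ratioOscillation_of_uniformBHP`.
Conclusion: hypothesis `H1` of
`KozdronLawler2005_martinRatioBoundaryLimit_of_martinKernelLimit_of_boundaryHarnack` — for a
boundary-vertex pole `q_δ → v`, `ψ(t) = v` (`HasBoundaryValue`), a base point `o_δ → ψ(i)`
and every interior `x` with approximants `x_δ`,
`G(x_δ, q_δ)/G(o_δ, q_δ) → Im z (1 + t²)/|z − t|²`, `z = ψ⁻¹x`.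
Proof (the pole is moved off the boundary by the boundary Harnack principle, then (GC) and the
continuum Martin kernel of `ℍ` take over): by symmetry `G(x_δ, q_δ)/G(o_δ, q_δ) =
G(q_δ, x_δ)/G(q_δ, o_δ)`, a ratio of two nonnegative functions of the first variable that are
harmonic for the killed walk within `R = min(|x − v|, |ψ(i) − v|)/2` of `v`; (UBHP) at `v`
(`v ∈ ∂D` by `mem_frontier_of_hasBoundaryValue_real`) compares it within a factor `(1 + ε)^{±1}`
with the same ratio at the approximants `y_δ` of an interior point `y` that is `r(ε)/2`-close
to `v`; by (GC) twice that ratio tends to `G_ℍ(ψ⁻¹y, z)/G_ℍ(ψ⁻¹y, i)`, which is within `ε` of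
the limit if `y` was chosen close to `v` (`tendsto_halfPlaneGreen_ratio` composed with
Carathéodory, `conformalEquiv_symm_tendsto_nhdsWithin_of_hasBoundaryValue`); so
`|G(x_δ,q_δ)/G(o_δ,q_δ) − K| ≤ (2K + 6) ε` eventually.
[cite: ChelkakWan2021, Cor. 3.3, Cor. 3.6 and Cor. 3.8] -/
theorem killedGreen_martinKernelLimit_of_greenConvergence_of_uniformBHP (D : JordanDomain)
    (ψ : ConformalEquiv upperHalfPlaneSet D.carrier)
    (hGC : ∃ c : ℝ, 0 < c ∧ ∀ x ∈ D.carrier, ∀ y ∈ D.carrier, x ≠ y → ∀ xs ys : ℝ → Site 2,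
      Tendsto (fun δ => meshPoint δ (xs δ)) (𝓝[>] 0) (𝓝 x) →
      Tendsto (fun δ => meshPoint δ (ys δ)) (𝓝[>] 0) (𝓝 y) →
      (∀ᶠ δ in 𝓝[>] 0, xs δ ∈ meshDomain D.carrier δ ∧ ys δ ∈ meshDomain D.carrier δ) →
      Tendsto (fun δ => SRW.killedGreen (discreteDomainGraph D.carrier δ) (xs δ) (ys δ)) (𝓝[>] 0)
        (𝓝 (c * Real.log (‖ψ.symm x - (starRingEnd ℂ) (ψ.symm y)‖ / ‖ψ.symm x - ψ.symm y‖))))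
    (hBHP : ∀ b ∈ frontier D.carrier, ∀ R > (0 : ℝ), ∀ η > (0 : ℝ), ∃ r > (0 : ℝ),
      ∀ᶠ δ in 𝓝[>] (0 : ℝ), ∀ h₁ h₂ : Site 2 → ℝ, (∀ z, 0 ≤ h₁ z) → (∀ z, 0 ≤ h₂ z) →
        (∀ z ∈ meshDomain D.carrier δ, dist (meshPoint δ z) b < R →
          h₁ z = 4⁻¹ * ∑ e : SRW.Dir 2,
            if (discreteDomainGraph D.carrier δ).Adj z (z + SRW.stepVec e)
            then h₁ (z + SRW.stepVec e) else 0) →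
        (∀ z ∈ meshDomain D.carrier δ, dist (meshPoint δ z) b < R →
          h₂ z = 4⁻¹ * ∑ e : SRW.Dir 2,
            if (discreteDomainGraph D.carrier δ).Adj z (z + SRW.stepVec e)
            then h₂ (z + SRW.stepVec e) else 0) →
        ∀ z z' : Site 2, z ∈ meshDomain D.carrier δ → z' ∈ meshDomain D.carrier δ →
          dist (meshPoint δ z) b < r → dist (meshPoint δ z') b < r →
          h₁ z * h₂ z' ≤ (1 + η) * (h₁ z' * h₂ z))
    {t : ℝ} {v : ℂ} (ht : ψ.HasBoundaryValue t v) (q o : ℝ → Site 2)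
    (hq : Tendsto (fun δ => meshPoint δ (q δ)) (𝓝[>] 0) (𝓝 v))
    (ho : Tendsto (fun δ => meshPoint δ (o δ)) (𝓝[>] 0) (𝓝 (ψ Complex.I)))
    (hmem : ∀ᶠ δ in 𝓝[>] 0, q δ ∈ meshBoundary D.carrier δ ∧ o δ ∈ meshDomain D.carrier δ)
    {x : ℂ} (hx : x ∈ D.carrier) (xs : ℝ → Site 2)
    (hxs : Tendsto (fun δ => meshPoint δ (xs δ)) (𝓝[>] 0) (𝓝 x))
    (hxmem : ∀ᶠ δ in 𝓝[>] 0, xs δ ∈ meshDomain D.carrier δ) :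
    Tendsto (fun δ => SRW.killedGreen (discreteDomainGraph D.carrier δ) (xs δ) (q δ) /
        SRW.killedGreen (discreteDomainGraph D.carrier δ) (o δ) (q δ)) (𝓝[>] 0)
      (𝓝 ((ψ.symm x).im * (1 + t ^ 2) / ‖ψ.symm x - t‖ ^ 2)) := by
  obtain ⟨c, hc, hGC⟩ := hGC
  -- the base point, the boundary point, the target constant
  have hI : Complex.I ∈ upperHalfPlaneSet := by
    show (0 : ℝ) < Complex.I.im
    simp
  have ho'D : ψ Complex.I ∈ D.carrier := ψ.mapsTo hI
  have hψo' : ψ.symm (ψ Complex.I) = Complex.I := ψ.symm_apply_apply hI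
  have hv : v ∈ frontier D.carrier := mem_frontier_of_hasBoundaryValue_real D ψ ht
  have hvD : v ∉ D.carrier := fun h => hv.2 (by rwa [D.isOpen.interior_eq])
  have hxv : 0 < dist x v := dist_pos.2 fun h => hvD (h ▸ hx)
  have ho'v : 0 < dist (ψ Complex.I) v := dist_pos.2 fun h => hvD (h ▸ ho'D)
  have hzxH : 0 < (ψ.symm x).im := ψ.symm_mapsTo hx
  set K : ℝ := (ψ.symm x).im * (1 + t ^ 2) / ‖ψ.symm x - t‖ ^ 2 with hK
  have hKpos : 0 < K := halfPlane_martinKernel_pos t (ψ.symm_mapsTo hx)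
  -- continuum: `G_ℍ(ψ⁻¹y, ψ⁻¹x)/G_ℍ(ψ⁻¹y, i) → K` as `y → v` inside `D`
  have hQ : Tendsto (fun y => Real.log (‖ψ.symm y - (starRingEnd ℂ) (ψ.symm x)‖ /
        ‖ψ.symm y - ψ.symm x‖) / Real.log (‖ψ.symm y - (starRingEnd ℂ) Complex.I‖ /
        ‖ψ.symm y - Complex.I‖)) (𝓝[D.carrier] v) (𝓝 K) := by
    have h1 := (tendsto_halfPlaneGreen_ratio t hzxH (by simp : (0 : ℝ) < Complex.I.im)).comp
      (conformalEquiv_symm_tendsto_nhdsWithin_of_hasBoundaryValue D ψ ht)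
    have hval : (ψ.symm x).im / ‖(t : ℂ) - ψ.symm x‖ ^ 2 /
        (Complex.I.im / ‖(t : ℂ) - Complex.I‖ ^ 2) = K := by
      have hn : ‖(t : ℂ) - Complex.I‖ ^ 2 = 1 + t ^ 2 := by
        rw [Complex.sq_norm, Complex.normSq_apply]
        simp
        ring
      have hne : ‖ψ.symm x - (t : ℂ)‖ ≠ 0 := by
        refine norm_ne_zero_iff.2 (sub_ne_zero.2 fun h => ?_)
        have := congrArg Complex.im h
        simp only [Complex.ofReal_im] at this
        linarith
      have h1t : (1 + t ^ 2) ≠ 0 := by positivity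
      rw [hn, Complex.I_im, norm_sub_rev (t : ℂ) (ψ.symm x), hK]
      field_simp
    rw [← hval]
    exact h1
  haveI hne : (𝓝[D.carrier] v).NeBot :=
    mem_closure_iff_nhdsWithin_neBot.1 (frontier_subset_closure hv)
  -- radius of harmonicity at `v`: the poles `x_δ`, `o_δ` stay `R`-away from `v`
  set R : ℝ := min (dist x v) (dist (ψ Complex.I) v) / 2 with hR
  have hR0 : 0 < R := by positivity
  have hRx : 2 * R ≤ dist x v := by
    simp only [hR]; linarith [min_le_left (dist x v) (dist (ψ Complex.I) v)]
  have hRo : 2 * R ≤ dist (ψ Complex.I) v := by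
    simp only [hR]; linarith [min_le_right (dist x v) (dist (ψ Complex.I) v)]
  have hδpos : ∀ᶠ δ in 𝓝[>] (0 : ℝ), 0 < δ := self_mem_nhdsWithin
  have hδlt : ∀ a : ℝ, 0 < a → ∀ᶠ δ in 𝓝[>] (0 : ℝ), δ < a := fun a ha =>
    mem_of_superset (Ioo_mem_nhdsGT ha) fun δ hδ => hδ.2
  -- the key estimate: for `0 < ε ≤ 1`, eventually `|M_δ - K| ≤ (2K + 6) ε`
  have key : ∀ ε : ℝ, 0 < ε → ε ≤ 1 → ∀ᶠ δ in 𝓝[>] 0,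
      |SRW.killedGreen (discreteDomainGraph D.carrier δ) (xs δ) (q δ) /
          SRW.killedGreen (discreteDomainGraph D.carrier δ) (o δ) (q δ) - K| ≤ (2 * K + 6) * ε := by
    intro ε hε hε1
    obtain ⟨r, hr, hB⟩ := hBHP v hv R hR0 ε hε
    -- an interior point `y` near `v` where the continuum ratio is within `ε` of `K`
    have hrR : 0 < min (r / 2) R := lt_min (half_pos hr) hR0
    have hev : ∀ᶠ y in 𝓝[D.carrier] v,
        dist (Real.log (‖ψ.symm y - (starRingEnd ℂ) (ψ.symm x)‖ / ‖ψ.symm y - ψ.symm x‖) /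
          Real.log (‖ψ.symm y - (starRingEnd ℂ) Complex.I‖ / ‖ψ.symm y - Complex.I‖)) K < ε ∧
        (dist y v < min (r / 2) R ∧ y ∈ D.carrier) := by
      refine (Metric.tendsto_nhds.1 hQ ε hε).and (Filter.inter_mem ?_ self_mem_nhdsWithin)
      exact mem_nhdsWithin_of_mem_nhds (Metric.ball_mem_nhds v hrR)
    obtain ⟨y, hQy, hyv, hyD⟩ := hev.exists
    have hyr : dist y v < r / 2 := hyv.trans_le (min_le_left _ _)
    have hyR : dist y v < R := hyv.trans_le (min_le_right _ _)
    have hyx : y ≠ x := fun h => by rw [h] at hyR; linarith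
    have hyo' : y ≠ ψ Complex.I := fun h => by rw [h] at hyR; linarith
    have hwy : 0 < (ψ.symm y).im := ψ.symm_mapsTo hyD
    have hg1 : 0 < Real.log (‖ψ.symm y - (starRingEnd ℂ) (ψ.symm x)‖ / ‖ψ.symm y - ψ.symm x‖) := by
      refine halfPlaneGreen_pos hwy hzxH fun h => hyx ?_
      rw [← ψ.apply_symm_apply hyD, ← ψ.apply_symm_apply hx, h]
    have hg2 : 0 < Real.log (‖ψ.symm y - (starRingEnd ℂ) Complex.I‖ / ‖ψ.symm y - Complex.I‖) := by
      refine halfPlaneGreen_pos hwy (by simp) fun h => hyo' ?_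
      rw [← ψ.apply_symm_apply hyD, h]
    -- lattice approximants of `y`
    set ys : ℝ → Site 2 := fun δ => nearestSite δ y with hys
    obtain ⟨η, hη, hηD⟩ := Metric.isOpen_iff.1 D.isOpen y hyD
    have hKD : closedBall y (η / 2) ⊆ D.carrier :=
      (closedBall_subset_ball (half_lt_self hη)).trans hηD
    have hys_dist : ∀ᶠ δ in 𝓝[>] (0 : ℝ), dist (meshPoint δ (ys δ)) y ≤ δ := by
      filter_upwards [hδpos] with δ hδ
      exact dist_meshPoint_nearestSite_le hδ y
    have hys_tend : Tendsto (fun δ => meshPoint δ (ys δ)) (𝓝[>] 0) (𝓝 y) := by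
      rw [tendsto_iff_dist_tendsto_zero]
      exact squeeze_zero' (Eventually.of_forall fun δ => dist_nonneg) hys_dist
        (tendsto_nhdsWithin_of_tendsto_nhds tendsto_id)
    have hys_mem : ∀ᶠ δ in 𝓝[>] (0 : ℝ), ys δ ∈ meshDomain D.carrier δ := by
      filter_upwards [D.eventually_forall_mem_meshDomain' (isCompact_closedBall y (η / 2)) hKD,
        hys_dist, hδlt _ (half_pos hη)] with δ hVδ hd hδη
      exact hVδ.1 _ (mem_closedBall.2 (hd.trans hδη.le))
    -- (GC) at `(y, x)` and `(y, ψ i)`: the lattice ratio at `y_δ` tends to the continuum ratio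
    have hL1 := hGC y hyD x hx hyx ys xs hys_tend hxs (hys_mem.and hxmem)
    have hL2 := hGC y hyD (ψ Complex.I) ho'D hyo' ys o hys_tend ho
      (hys_mem.and (hmem.mono fun δ h => h.2))
    rw [hψo'] at hL2
    have hRat : Tendsto (fun δ => SRW.killedGreen (discreteDomainGraph D.carrier δ) (ys δ) (xs δ) /
        SRW.killedGreen (discreteDomainGraph D.carrier δ) (ys δ) (o δ)) (𝓝[>] 0)
        (𝓝 (Real.log (‖ψ.symm y - (starRingEnd ℂ) (ψ.symm x)‖ / ‖ψ.symm y - ψ.symm x‖) /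
          Real.log (‖ψ.symm y - (starRingEnd ℂ) Complex.I‖ / ‖ψ.symm y - Complex.I‖))) := by
      have := hL1.div hL2 (mul_pos hc hg2).ne'
      rwa [mul_div_mul_left _ _ hc.ne'] at this
    have hRat_close := Metric.tendsto_nhds.1 hRat ε hε
    -- poles far from `v`, evaluation points close to `v`
    have hxs_far : ∀ᶠ δ in 𝓝[>] (0 : ℝ), R < dist (meshPoint δ (xs δ)) v := by
      filter_upwards [Metric.tendsto_nhds.1 hxs R hR0] with δ hδ
      rw [dist_comm] at hδ
      linarith [dist_triangle x (meshPoint δ (xs δ)) v]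
    have ho_far : ∀ᶠ δ in 𝓝[>] (0 : ℝ), R < dist (meshPoint δ (o δ)) v := by
      filter_upwards [Metric.tendsto_nhds.1 ho R hR0] with δ hδ
      rw [dist_comm] at hδ
      linarith [dist_triangle (ψ Complex.I) (meshPoint δ (o δ)) v]
    have hq_close : ∀ᶠ δ in 𝓝[>] (0 : ℝ), dist (meshPoint δ (q δ)) v < r :=
      Metric.tendsto_nhds.1 hq r hr
    have hys_close : ∀ᶠ δ in 𝓝[>] (0 : ℝ), dist (meshPoint δ (ys δ)) v < r := by
      filter_upwards [hys_dist, hδlt _ (half_pos hr)] with δ hd hδr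
      calc dist (meshPoint δ (ys δ)) v ≤ dist (meshPoint δ (ys δ)) y + dist y v :=
            dist_triangle _ _ _
        _ < r / 2 + r / 2 := add_lt_add (hd.trans_lt hδr) hyr
        _ = r := by ring
    filter_upwards [hB, D.eventually_killedGreen_pos, hmem, hxmem, hys_mem, hδpos, hxs_far, ho_far,
      hq_close, hys_close, hRat_close] with δ hBδ hpos hmemδ hxmemδ hysδ hδ hxsδ hoδ hqδ hysvδ hRatδ
    have hqm : q δ ∈ meshDomain D.carrier δ := meshBoundary_subset_meshDomain _ _ hmemδ.1
    have hom : o δ ∈ meshDomain D.carrier δ := hmemδ.2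
    -- harmonicity within `R` of `v` of `G(·, x_δ)` and `G(·, o_δ)`
    have harm : ∀ p : Site 2, R < dist (meshPoint δ p) v → ∀ z ∈ meshDomain D.carrier δ,
        dist (meshPoint δ z) v < R → SRW.killedGreen (discreteDomainGraph D.carrier δ) z p =
          4⁻¹ * ∑ e' : SRW.Dir 2, if (discreteDomainGraph D.carrier δ).Adj z (z + SRW.stepVec e')
            then SRW.killedGreen (discreteDomainGraph D.carrier δ) (z + SRW.stepVec e') p else 0 := by
      intro p hp z _ hz
      have hzp : z ≠ p := by rintro rfl; linarith
      exact killedGreen_discreteDomainGraph_harmonic D.isBounded hδ hzp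
    have h1 := hBδ (fun z => SRW.killedGreen (discreteDomainGraph D.carrier δ) z (xs δ))
      (fun z => SRW.killedGreen (discreteDomainGraph D.carrier δ) z (o δ))
      (fun z => SRW.killedGreen_nonneg _ _ _) (fun z => SRW.killedGreen_nonneg _ _ _)
      (harm _ hxsδ) (harm _ hoδ) (q δ) (ys δ) hqm hysδ hqδ hysvδ
    have h2 := hBδ (fun z => SRW.killedGreen (discreteDomainGraph D.carrier δ) z (xs δ))
      (fun z => SRW.killedGreen (discreteDomainGraph D.carrier δ) z (o δ))
      (fun z => SRW.killedGreen_nonneg _ _ _) (fun z => SRW.killedGreen_nonneg _ _ _)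
      (harm _ hxsδ) (harm _ hoδ) (ys δ) (q δ) hysδ hqm hysvδ hqδ
    -- `h1 : G(q,x) G(y,o) ≤ (1+ε) G(y,x) G(q,o)`, `h2 : G(y,x) G(q,o) ≤ (1+ε) G(q,x) G(y,o)`
    rw [SRW.killedGreen_comm _ (q δ) (xs δ), SRW.killedGreen_comm _ (q δ) (o δ)] at h1 h2
    have hGoq : 0 < SRW.killedGreen (discreteDomainGraph D.carrier δ) (o δ) (q δ) := hpos _ hom _ hqm
    have hGyo : 0 < SRW.killedGreen (discreteDomainGraph D.carrier δ) (ys δ) (o δ) := hpos _ hysδ _ hom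
    have hGyx : 0 < SRW.killedGreen (discreteDomainGraph D.carrier δ) (ys δ) (xs δ) :=
      hpos _ hysδ _ hxmemδ
    -- abbreviate the four numbers
    generalize hMd : SRW.killedGreen (discreteDomainGraph D.carrier δ) (xs δ) (q δ) /
        SRW.killedGreen (discreteDomainGraph D.carrier δ) (o δ) (q δ) = M
    generalize hRtd : SRW.killedGreen (discreteDomainGraph D.carrier δ) (ys δ) (xs δ) /
        SRW.killedGreen (discreteDomainGraph D.carrier δ) (ys δ) (o δ) = Rt at hRatδ
    generalize hQd : Real.log (‖ψ.symm y - (starRingEnd ℂ) (ψ.symm x)‖ / ‖ψ.symm y - ψ.symm x‖) /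
        Real.log (‖ψ.symm y - (starRingEnd ℂ) Complex.I‖ / ‖ψ.symm y - Complex.I‖) = Q
        at hQy hRatδ
    have hM1 : M ≤ (1 + ε) * Rt := by
      rw [← hMd, ← hRtd, div_le_iff₀ hGoq,
        show (1 + ε) * (SRW.killedGreen (discreteDomainGraph D.carrier δ) (ys δ) (xs δ) /
            SRW.killedGreen (discreteDomainGraph D.carrier δ) (ys δ) (o δ)) *
            SRW.killedGreen (discreteDomainGraph D.carrier δ) (o δ) (q δ) =
          (1 + ε) * (SRW.killedGreen (discreteDomainGraph D.carrier δ) (ys δ) (xs δ) *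
            SRW.killedGreen (discreteDomainGraph D.carrier δ) (o δ) (q δ)) /
            SRW.killedGreen (discreteDomainGraph D.carrier δ) (ys δ) (o δ) by ring,
        le_div_iff₀ hGyo]
      linarith
    have hM2 : Rt ≤ (1 + ε) * M := by
      rw [← hMd, ← hRtd, div_le_iff₀ hGyo,
        show (1 + ε) * (SRW.killedGreen (discreteDomainGraph D.carrier δ) (xs δ) (q δ) /
            SRW.killedGreen (discreteDomainGraph D.carrier δ) (o δ) (q δ)) *
            SRW.killedGreen (discreteDomainGraph D.carrier δ) (ys δ) (o δ) =
          (1 + ε) * (SRW.killedGreen (discreteDomainGraph D.carrier δ) (xs δ) (q δ) *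
            SRW.killedGreen (discreteDomainGraph D.carrier δ) (ys δ) (o δ)) /
            SRW.killedGreen (discreteDomainGraph D.carrier δ) (o δ) (q δ) by ring,
        le_div_iff₀ hGoq]
      linarith
    have hRtnn : 0 ≤ Rt := by rw [← hRtd]; exact div_nonneg hGyx.le hGyo.le
    rw [Real.dist_eq] at hQy hRatδ
    exact abs_sub_le_of_mul_close hε hε1 hM1 hM2 hRtnn hQy hRatδ
  -- conclusion
  rw [Metric.tendsto_nhds]
  intro ε₀ hε₀
  have hC : 0 < 2 * K + 6 := by positivity
  set ε : ℝ := min 1 (ε₀ / (2 * (2 * K + 6))) with hεdef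
  have hε : 0 < ε := lt_min one_pos (by positivity)
  have hε1 : ε ≤ 1 := min_le_left _ _
  have hε2 : ε ≤ ε₀ / (2 * (2 * K + 6)) := min_le_right _ _
  filter_upwards [key ε hε hε1] with δ hδ
  rw [Real.dist_eq]
  calc _ ≤ (2 * K + 6) * ε := hδ
    _ ≤ (2 * K + 6) * (ε₀ / (2 * (2 * K + 6))) := by gcongr
    _ = ε₀ / 2 := by field_simp
    _ < ε₀ := half_lt_self hε₀

/-- **`KozdronLawler2005_martinRatioBoundaryLimit` from (GC) and (UBHP) for the edge-killed
walk** — the named fact reduced to the two inputs that the crux `SAWLoopFugacityFlow.AvoidanceLimit`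
of `Summits/CriticalPhenomena/SAWScalingLimit` isolates for the SAME walk (stubs
`stub_greenConvergence` (GC) and the uniform boundary Harnack principle (UBHP) of
`…AvoidanceLimitInteriorRatioLimitReduction.lean` / `…AvoidanceLimitRatioOscillationReduction.lean`),
here universally quantified over Jordan domains: (GC) interior convergence of the Green
function of the walk on `discreteDomainGraph D δ` to `c · G_ℍ ∘ ψ⁻¹` (the analogue of
Chelkak–Wan 2021, Cor. 3.3; for interior points it is sandwiched between two instances of the
vertex-killed statement `killedGreen_tendsto_of_kernelConvergence` by `SRW.killedGreen_mono`),
and (UBHP) the uniform boundary Harnack principle at boundary points in Euclidean balls (the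
analogue of ibid., Cor. 3.8). Assembly: `H1` by
`killedGreen_martinKernelLimit_of_greenConvergence_of_uniformBHP`, `H2` by
`killedGreen_ratioOscillation_of_uniformBHP`, then
`KozdronLawler2005_martinRatioBoundaryLimit_of_martinKernelLimit_of_boundaryHarnack`. Neither
(GC) nor (UBHP) is asserted: for the edge-killed discretisation they are in no printed source
(Chelkak 2016, §2.2 only remarks that the induced-subgraph assumption "can be easily removed").
[cite: ChelkakWan2021, Cor. 3.3, Cor. 3.6 and Cor. 3.8] -/
theorem KozdronLawler2005_martinRatioBoundaryLimit_of_greenConvergence_of_uniformBHP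
    (hGC : ∀ (D : JordanDomain) (ψ : ConformalEquiv upperHalfPlaneSet D.carrier),
      ∃ c : ℝ, 0 < c ∧ ∀ x ∈ D.carrier, ∀ y ∈ D.carrier, x ≠ y → ∀ xs ys : ℝ → Site 2,
      Tendsto (fun δ => meshPoint δ (xs δ)) (𝓝[>] 0) (𝓝 x) →
      Tendsto (fun δ => meshPoint δ (ys δ)) (𝓝[>] 0) (𝓝 y) →
      (∀ᶠ δ in 𝓝[>] 0, xs δ ∈ meshDomain D.carrier δ ∧ ys δ ∈ meshDomain D.carrier δ) →
      Tendsto (fun δ => SRW.killedGreen (discreteDomainGraph D.carrier δ) (xs δ) (ys δ)) (𝓝[>] 0)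
        (𝓝 (c * Real.log (‖ψ.symm x - (starRingEnd ℂ) (ψ.symm y)‖ / ‖ψ.symm x - ψ.symm y‖))))
    (hBHP : ∀ (D : JordanDomain), ∀ b ∈ frontier D.carrier, ∀ R > (0 : ℝ), ∀ η > (0 : ℝ),
      ∃ r > (0 : ℝ), ∀ᶠ δ in 𝓝[>] (0 : ℝ), ∀ h₁ h₂ : Site 2 → ℝ,
        (∀ z, 0 ≤ h₁ z) → (∀ z, 0 ≤ h₂ z) →
        (∀ z ∈ meshDomain D.carrier δ, dist (meshPoint δ z) b < R →
          h₁ z = 4⁻¹ * ∑ e : SRW.Dir 2,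
            if (discreteDomainGraph D.carrier δ).Adj z (z + SRW.stepVec e)
            then h₁ (z + SRW.stepVec e) else 0) →
        (∀ z ∈ meshDomain D.carrier δ, dist (meshPoint δ z) b < R →
          h₂ z = 4⁻¹ * ∑ e : SRW.Dir 2,
            if (discreteDomainGraph D.carrier δ).Adj z (z + SRW.stepVec e)
            then h₂ (z + SRW.stepVec e) else 0) →
        ∀ z z' : Site 2, z ∈ meshDomain D.carrier δ → z' ∈ meshDomain D.carrier δ →
          dist (meshPoint δ z) b < r → dist (meshPoint δ z') b < r →
          h₁ z * h₂ z' ≤ (1 + η) * (h₁ z' * h₂ z)) :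
    KozdronLawler2005_martinRatioBoundaryLimit :=
  KozdronLawler2005_martinRatioBoundaryLimit_of_martinKernelLimit_of_boundaryHarnack
    (fun D ψ _t _v ht q o hq ho hmem _x hx xs hxs hxmem =>
      killedGreen_martinKernelLimit_of_greenConvergence_of_uniformBHP D ψ (hGC D ψ) (hBHP D) ht
        q o hq ho hmem hx xs hxs hxmem)
    (fun D _u _v _w hu huv huw q e hq he hmem =>
      killedGreen_ratioOscillation_of_uniformBHP D (hBHP D) hu huv huw q e hq he hmem)

end GreenConvergenceInputs

/-! ### The fact from the uniform boundary Harnack principle alone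

With (GC) now a theorem of the tree for the edge-killed walk on `discreteDomainGraph` of a Jordan
domain (`JordanDomain.killedGreen_discreteDomainGraph_tendsto`,
`DiscreteGreenKernelConvergenceJordan.lean`: inner/outer hole-free sandwich around the proved
Chelkak–Wan Cor. 3.3, `killedGreen_tendsto_of_kernelConvergence_holds`), the named fact is reduced to
the single remaining input (UBHP) — the uniform boundary Harnack principle for the edge-killed walk at
a boundary point of a Jordan domain, in Euclidean balls, division-free (the analogue of Chelkak–Wan
2021, Lemma 3.7 / Cor. 3.8, in no printed source for this discretisation; the stub
`stub_uniformBHP` of crux `SAWLoopFugacityFlow.AvoidanceLimit` is the same statement at the marked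
points of a Dobrushin domain). -/

section FromUBHP

open _root_.Metric
open scoped Classical

/-- **`KozdronLawler2005_martinRatioBoundaryLimit` from (UBHP) alone.** The hypothesis is the
uniform boundary Harnack principle for the edge-killed walk on `discreteDomainGraph D δ` at the
boundary points of Jordan domains, exactly as in
`KozdronLawler2005_martinRatioBoundaryLimit_of_greenConvergence_of_uniformBHP`; its other
hypothesis (GC) is discharged by `JordanDomain.killedGreen_discreteDomainGraph_tendsto`. (UBHP) is
not asserted. [cite: ChelkakWan2021, Cor. 3.3 and Cor. 3.8] -/
theorem KozdronLawler2005_martinRatioBoundaryLimit_of_uniformBHP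
    (hBHP : ∀ (D : JordanDomain), ∀ b ∈ frontier D.carrier, ∀ R > (0 : ℝ), ∀ η > (0 : ℝ),
      ∃ r > (0 : ℝ), ∀ᶠ δ in 𝓝[>] (0 : ℝ), ∀ h₁ h₂ : Site 2 → ℝ,
        (∀ z, 0 ≤ h₁ z) → (∀ z, 0 ≤ h₂ z) →
        (∀ z ∈ meshDomain D.carrier δ, dist (meshPoint δ z) b < R →
          h₁ z = 4⁻¹ * ∑ e : SRW.Dir 2,
            if (discreteDomainGraph D.carrier δ).Adj z (z + SRW.stepVec e)
            then h₁ (z + SRW.stepVec e) else 0) →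
        (∀ z ∈ meshDomain D.carrier δ, dist (meshPoint δ z) b < R →
          h₂ z = 4⁻¹ * ∑ e : SRW.Dir 2,
            if (discreteDomainGraph D.carrier δ).Adj z (z + SRW.stepVec e)
            then h₂ (z + SRW.stepVec e) else 0) →
        ∀ z z' : Site 2, z ∈ meshDomain D.carrier δ → z' ∈ meshDomain D.carrier δ →
          dist (meshPoint δ z) b < r → dist (meshPoint δ z') b < r →
          h₁ z * h₂ z' ≤ (1 + η) * (h₁ z' * h₂ z)) :
    KozdronLawler2005_martinRatioBoundaryLimit :=
  KozdronLawler2005_martinRatioBoundaryLimit_of_greenConvergence_of_uniformBHP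
    (fun D ψ => D.killedGreen_discreteDomainGraph_tendsto ψ) hBHP

end FromUBHP

end Literature.Probability.LatticeModels
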